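import Mathlib
import Literature.NumberTheory.EllipticCurves.ModularSymbolRep
import Literature.NumberTheory.EllipticCurves.ModularFormsGamma0FreeModule
import Literature.NumberTheory.Automorphic.ModularPartitionOfUnity
import Literature.NumberTheory.Automorphic.ZhouLegendreGreenValues
import Literature.NumberTheory.Automorphic.InvariantLaplacian
import Literature.NumberTheory.Automorphic.HigherGreenFunctionCM
import Literature.NumberTheory.Automorphic.HigherGreenFunctionCMProofs
import Literature.NumberTheory.Automorphic.HigherGreenFunctionProofs
import HarnessLib

/-!
# The level-one weight-4 Green function at `ρ` as an Eichler integral of `Δ/E₄²`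

[topic NumberTheory/Automorphic]

Support file for `Literature.NumberTheory.Automorphic.Zhou2015_legendreP_sq_integral`
(Zhou 2015, Remark 9, level `1`): we construct the automorphic Green function
`G₂^{PSL₂(ℤ)}(z, ρ')`, `ρ' = (1 + i√3)/2 = cmRho`, EXPLICITLY from the Eichler integral of the
meromorphic weight-4 form `f = Δ/E₄²` (double pole on the orbit of `ρ`), following the
"Kontsevich–Zagier integral representation" philosophy of Zhou (Zhou 2015 §2.2, Prop. 2.2.2 and
Remark 9: `G₂(z, ρ)` is an integral of `E₄`-data along the imaginary axis), and identify it with the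
tree's `higherGreen 1 2 1 · cmRho` by the uniqueness of resolvent Green functions
(`resolventGreen_unique_holds`, `higherGreen_isResolventGreenLike_holds`).

## Construction and main results (all sorry-free)

* §1–2 `fΔE4 = Δ/E₄²`: `f(−1/z) = z⁴ f(z)`, `f(z+1) = f(z)`, holomorphic on `Im z > a₀ := √3/2`;
  the shifted cusp function `φρ = f(· + i a₀)` (`isCuspFunction_φρ`) and the moments
  `M_j(w) = ∫_w^{i∞} f(ζ) ζ^j dζ` (`j ≤ 2`) via the tree's `powPrimitive`.
* §3–4 centered moments `A₁ = M₁ − wM₀`, `A₂ = M₂ − 2wM₁ + w²M₀` and the **`S`-transformation laws on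
  the lens** `{Im w > a₀, a₀|w|² < Im w}` (`M₀_Sc`, `A₁_Sc`, `A₂_Sc`), proved by zero derivative on a
  convex set (no contour deformation).
* §5–6 `Fbase(w) := Im A₂(w)/Im w + 2 Re A₁(w) + λ/Im w` is `1`-periodic, `S`-invariant on the lens
  (`Fbase_Sc`, granted `Im M₁(i) = 0`), `C²` with `(Im w)² Δ Fbase = 2·Fbase` (`laplacian_Fbase`).
* §7 extension `Fρ` to `ℍ` through the fundamental domain; `IsResolventGreenLike 1 2 cmRho Fρ`
  (`isResolventGreenLike_Fρ`): invariance, `C²`, eigen-equation, cusp decay.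
* §8 local expansion `f = a(ζ−ρ')⁻² + b(ζ−ρ')⁻¹ + h`, `a = Δ(ρ')/E₄'(ρ')² = 1/(768π²)` (`aρ_eq`), and
  `Fρ(z) = −2a·log‖z − ρ'‖ + O(1)` (`Fρ_log_bound`).
* §9 `#Stab_{Γ₀(1)}(ρ') = 6` (`card_stabilizer_cmRho`) and, by uniqueness,
  **`higherGreen 1 2 1 z cmRho = C₀ · Fρ z`**, `C₀ = −6/a = −4608π²` (`higherGreen_eq_C₀_mul_Fρ`);
  at `z = i`: `higherGreen 1 2 1 i cmRho = C₀ · Fbase(i)` (`higherGreen_I_cmRho`).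
* §10 `Fbase(i) = 2 Im M₀(i)` and `M₀(i) = i ∫_{t>1} f(it) dt` (`Fbase_I`, `M₀_I`).
* §11 given that `f(it)` is real (`hr`) and the value of `∫_{t>1} f(it) dt` (`hL`):
  `Im M₁(i) = 0` (`M₁_I_im_eq_zero`) and **Remark 9 (ii)a**
  `higherGreen 1 2 1 cmRho i = −(16π/3)·L` (`higherGreen_cmRho_I_of_axis`).

The two real-axis inputs — `Δ(it)/E₄(it)² ∈ ℝ` and
`∫_{t>1} Δ(it)/E₄(it)² dt = (1728π)⁻¹ ∫₀¹ P_{−1/6}(ξ)² dξ` — are supplied by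
`Literature.NumberTheory.ModularForms.DiscriminantOverE4SqAxisIntegral`.

## References

* Y. Zhou, *Kontsevich–Zagier integrals for automorphic Green's functions. I*, Ramanujan J. 38
  (2015), §2.2 and Remark 9. [cite: Zhou2015, Remark 9]
* B. Gross, D. Zagier, *Heegner points and derivatives of L-series*, Invent. Math. 84 (1986),
  §II.2 (resolvent Green functions: characterisation (a)–(c) and uniqueness). [cite: GrossZagier1986, §II.2]
* D. Zagier, *Elliptic modular forms and their applications* (2008), §5.4 (Eichler integrals). [folklore]
-/

noncomputable section

open UpperHalfPlane hiding I
open Complex Filter Topology ModularForm EisensteinSeries Real Set MeasureTheory Laplacian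
open scoped MatrixGroups Manifold Topology

namespace Literature.NumberTheory.Automorphic.GreenRho

open Literature.NumberTheory.EllipticCurves.ModularForms

/-! ## 1. The weight-4 meromorphic form `f = Δ/E₄²` -/

/-- `f := Δ/E₄²` (junk `0` at the zeros of `E₄`, the orbit of `ρ`). [folklore] -/
def fΔE4 (z : ℍ) : ℂ := ModularForm.discriminant z / E₄ z ^ 2

/-- The height of the pole orbit: `Im(γρ) ≤ √3/2` for all `γ ∈ SL₂(ℤ)`. [folklore] -/
theorem im_smul_rho_le (γ : SL(2, ℤ)) : (γ • UpperHalfPlane.ρ).im ≤ Real.sqrt 3 / 2 := by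
  have h := im_smul_le_im_of_mem_fd ModularGroup.ρ_mem_fd γ
  simpa [UpperHalfPlane.ρ] using h

/-- `E₄(z) ≠ 0` when `Im z > √3/2` (the zeros of `E₄` are the orbit of `ρ`). [folklore] -/
theorem E₄_ne_zero_of_im_gt {z : ℍ} (hz : Real.sqrt 3 / 2 < z.im) : E₄ z ≠ 0 := by
  intro h0
  obtain ⟨γ, hγ⟩ := E₄_eq_zero_iff.mp h0
  have := im_smul_rho_le γ
  rw [hγ] at this
  linarith

/-- `f(−1/z) = z⁴ f(z)` (weight `4 = 12 − 2·4`, level one). [folklore] -/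
theorem fΔE4_S_smul (z : ℍ) : fΔE4 (ModularGroup.S • z) = (z : ℂ) ^ 4 * fΔE4 z := by
  rw [fΔE4, fΔE4, discriminant_apply_smul, levelOne_apply_smul E₄]
  rw [ModularGroup.denom_S]
  rcases eq_or_ne (E₄ z) 0 with h | h
  · simp [h]
  · have hz : (z : ℂ) ≠ 0 := ne_zero z
    simp only [zpow_ofNat]
    field_simp

/-- `f(z + 1) = f(z)`. [folklore] -/
theorem fΔE4_T_smul (z : ℍ) : fΔE4 (ModularGroup.T • z) = fΔE4 z := by
  rw [fΔE4, fΔE4, discriminant_apply_smul, levelOne_apply_smul E₄]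
  have : denom (ModularGroup.T : SL(2,ℤ)) z = 1 := by
    rw [ModularGroup.denom_apply]; simp [ModularGroup.T]
  rw [this]; simp

/-- `f ∘ ofComplex` is holomorphic at every `w` with `Im w > √3/2`. [folklore] -/
theorem differentiableAt_fΔE4 {w : ℂ} (hw : Real.sqrt 3 / 2 < w.im) :
    DifferentiableAt ℂ (fΔE4 ∘ ofComplex) w := by
  have hw0 : 0 < w.im := lt_trans (by positivity) hw
  have hΔ := (UpperHalfPlane.mdifferentiable_iff.mp (ModularFormClass.holo
    (ModularFormClass.modularForm CuspForm.discriminant))).differentiableAt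
    (isOpen_upperHalfPlaneSet.mem_nhds hw0)
  have hE := (UpperHalfPlane.mdifferentiable_iff.mp (ModularFormClass.holo E₄)).differentiableAt
    (isOpen_upperHalfPlaneSet.mem_nhds hw0)
  have hne : E₄ (ofComplex w) ^ 2 ≠ 0 := by
    apply pow_ne_zero
    apply E₄_ne_zero_of_im_gt
    rwa [← UpperHalfPlane.coe_im, ofComplex_apply_of_im_pos hw0]
  have h := hΔ.div (hE.pow 2) hne
  refine h.congr_of_eventuallyEq (Eventually.of_forall fun u => ?_)
  simp [fΔE4, Function.comp_apply]

/-! ## 2. The shifted cusp function `φ(τ) = f(τ + i√3/2)` -/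

/-- The height of the pole orbit, `a₀ = Im ρ = √3/2`. [folklore] -/
def a₀ : ℝ := Real.sqrt 3 / 2

/-- Auxiliary step `a₀_pos` of the Eichler-integral construction. [folklore] -/
theorem a₀_pos : 0 < a₀ := by rw [a₀]; positivity

/-- Auxiliary step `a₀_lt_one` of the Eichler-integral construction. [folklore] -/
theorem a₀_lt_one : a₀ < 1 := by
  rw [a₀, div_lt_one two_pos]
  have : Real.sqrt 3 < Real.sqrt 4 := Real.sqrt_lt_sqrt (by norm_num) (by norm_num)
  rwa [show Real.sqrt 4 = 2 by rw [show (4:ℝ) = 2 ^ 2 by norm_num, Real.sqrt_sq (by norm_num)]] at this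

/-- The shift `τ ↦ τ + i a₀`. [folklore] -/
def shiftUp (τ : ℍ) : ℍ := ⟨(τ : ℂ) + (a₀ : ℂ) * Complex.I, by
  simp only [Complex.add_im, UpperHalfPlane.coe_im, Complex.mul_im, Complex.ofReal_re,
    Complex.I_im, mul_one, Complex.ofReal_im, Complex.I_re, mul_zero, add_zero]
  exact add_pos τ.im_pos a₀_pos⟩

/-- Coercion of `shiftUp`. [folklore] -/
@[simp] theorem coe_shiftUp (τ : ℍ) : ((shiftUp τ : ℍ) : ℂ) = (τ : ℂ) + (a₀ : ℂ) * Complex.I := rfl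

/-- Auxiliary step `shiftUp_im` of the Eichler-integral construction. [folklore] -/
theorem shiftUp_im (τ : ℍ) : (shiftUp τ).im = τ.im + a₀ := by
  rw [← UpperHalfPlane.coe_im, coe_shiftUp]; simp

/-- Auxiliary step `shiftUp_ofComplex` of the Eichler-integral construction. [folklore] -/
theorem shiftUp_ofComplex {w : ℂ} (hw : 0 < w.im) :
    shiftUp (ofComplex w) = ofComplex (w + (a₀ : ℂ) * Complex.I) := by
  apply UpperHalfPlane.ext
  rw [coe_shiftUp, ofComplex_apply_of_im_pos hw,
    ofComplex_apply_of_im_pos (by simp; linarith [a₀_pos])]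

/-- `φ := f ∘ shiftUp`, a genuine cusp function on `ℍ`. [folklore] -/
def φρ (τ : ℍ) : ℂ := fΔE4 (shiftUp τ)

/-- Auxiliary step `φρ_ofComplex` of the Eichler-integral construction. [folklore] -/
theorem φρ_ofComplex {w : ℂ} (hw : 0 < w.im) :
    φρ (ofComplex w) = (fΔE4 ∘ ofComplex) (w + (a₀ : ℂ) * Complex.I) := by
  rw [φρ, shiftUp_ofComplex hw, Function.comp_apply]

/-- `Δ(it) → 0`, `E₄ → 1`, so `f → 0` at `i∞`. [folklore] -/
theorem tendsto_fΔE4_atImInfty : Tendsto fΔE4 atImInfty (𝓝 0) := by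
  have hΔ : Tendsto (fun z : ℍ => ModularForm.discriminant z) atImInfty (𝓝 0) := by
    have h := ((tendsto_E4_atImInfty.pow 3).sub (tendsto_E6_atImInfty.pow 2)).div_const 1728
    simp only [one_pow, sub_self, zero_div] at h
    refine h.congr fun z => ?_
    rw [ModularForm.discriminant_eq_E₄_cube_sub_E₆_sq]
  have h := hΔ.div (tendsto_E4_atImInfty.pow 2) (by norm_num)
  rw [zero_div] at h
  refine h.congr fun z => ?_
  simp [fΔE4]

/-- Auxiliary step `tendsto_shiftUp_atImInfty` of the Eichler-integral construction. [folklore] -/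
theorem tendsto_shiftUp_atImInfty : Tendsto shiftUp atImInfty atImInfty := by
  rw [atImInfty, tendsto_comap_iff]
  have : (UpperHalfPlane.im ∘ shiftUp) = fun τ => τ.im + a₀ := funext fun τ => shiftUp_im τ
  rw [this]
  exact tendsto_atTop_add_const_right _ a₀ tendsto_comap

/-- **`φ` is a cusp function** (`1`-periodic, holomorphic on `ℍ`, `→ 0` at `i∞`). [folklore] -/
theorem isCuspFunction_φρ : IsCuspFunction 1 φρ where
  pos := one_pos
  periodic := by
    intro w
    simp only [Function.comp_apply, Complex.ofReal_one]
    by_cases hw : 0 < w.im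
    · have hw1 : 0 < (w + 1).im := by simpa using hw
      rw [φρ_ofComplex hw, φρ_ofComplex hw1, Function.comp_apply, Function.comp_apply]
      have him : 0 < (w + (a₀ : ℂ) * Complex.I).im := by simp; linarith [a₀_pos]
      have e : w + 1 + (a₀ : ℂ) * Complex.I = (w + (a₀ : ℂ) * Complex.I) + 1 := by ring
      rw [e]
      have hT : ofComplex (w + (a₀ : ℂ) * Complex.I + 1) =
          ModularGroup.T • ofComplex (w + (a₀ : ℂ) * Complex.I) := by
        apply UpperHalfPlane.ext
        rw [ofComplex_apply_of_im_pos (by simpa using him), UpperHalfPlane.modular_T_smul,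
          UpperHalfPlane.coe_vadd, ofComplex_apply_of_im_pos him]
        push_cast; ring
      rw [hT, fΔE4_T_smul]
    · push Not at hw
      have hw1 : (w + 1).im ≤ 0 := by simpa using hw
      rw [φρ, φρ, ofComplex_apply_of_im_nonpos hw1, ofComplex_apply_of_im_nonpos hw]
  mdifferentiable := by
    rw [UpperHalfPlane.mdifferentiable_iff]
    intro w hw
    have hw' : 0 < w.im := hw
    have hd : DifferentiableAt ℂ (fun u : ℂ => (fΔE4 ∘ ofComplex) (u + (a₀ : ℂ) * Complex.I)) w := by
      have h1 := differentiableAt_fΔE4 (w := w + (a₀ : ℂ) * Complex.I) (by simp [a₀]; linarith)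
      have h2 : DifferentiableAt ℂ (fun u : ℂ => u + (a₀ : ℂ) * Complex.I) w :=
        differentiableAt_id.add_const _
      exact DifferentiableAt.comp (g := fΔE4 ∘ ofComplex) w h1 h2
    refine (hd.congr_of_eventuallyEq ?_).differentiableWithinAt
    filter_upwards [isOpen_upperHalfPlaneSet.mem_nhds hw'] with u hu
    exact φρ_ofComplex hu
  isZeroAtImInfty := by
    rw [UpperHalfPlane.IsZeroAtImInfty, ZeroAtFilter]
    exact tendsto_fΔE4_atImInfty.comp tendsto_shiftUp_atImInfty

/-! ## 3. Moments of `f` along vertical rays: `M_j(w) = ∫_w^{i∞} f(ζ) ζʲ dζ` (`Im w > a₀`) -/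

/-- `P_k(τ) := powPrimitive k φ τ` through `ofComplex`. [folklore] -/
def Pk (k : ℕ) (τ : ℂ) : ℂ := powPrimitive k φρ (ofComplex τ)

/-- Auxiliary step `hasDerivAt_Pk` of the Eichler-integral construction. [folklore] -/
theorem hasDerivAt_Pk (k : ℕ) {τ : ℂ} (hτ : 0 < τ.im) :
    HasDerivAt (Pk k) (-(φρ (ofComplex τ) * τ ^ k)) τ :=
  isCuspFunction_φρ.hasDerivAt_powPrimitive k hτ

/-- `f(w)` through `ofComplex` equals `φ(w − i a₀)`. [folklore] -/
theorem φρ_ofComplex_sub {w : ℂ} (hw : a₀ < w.im) :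
    φρ (ofComplex (w - (a₀ : ℂ) * Complex.I)) = fΔE4 (ofComplex w) := by
  have h : 0 < (w - (a₀ : ℂ) * Complex.I).im := by simp; linarith
  rw [φρ_ofComplex h, Function.comp_apply, sub_add_cancel]

/-- `M₀(w) = ∫_w^{i∞} f`. [folklore] -/
def M₀ (w : ℂ) : ℂ := Pk 0 (w - (a₀ : ℂ) * Complex.I)
/-- `M₁(w) = ∫_w^{i∞} f(ζ) ζ dζ`. [folklore] -/
def M₁ (w : ℂ) : ℂ := Pk 1 (w - (a₀ : ℂ) * Complex.I) + (a₀ : ℂ) * Complex.I * Pk 0 (w - (a₀ : ℂ) * Complex.I)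
/-- `M₂(w) = ∫_w^{i∞} f(ζ) ζ² dζ`. [folklore] -/
def M₂ (w : ℂ) : ℂ := Pk 2 (w - (a₀ : ℂ) * Complex.I) +
  2 * ((a₀ : ℂ) * Complex.I) * Pk 1 (w - (a₀ : ℂ) * Complex.I) +
  ((a₀ : ℂ) * Complex.I) ^ 2 * Pk 0 (w - (a₀ : ℂ) * Complex.I)

/-- `fC w := f(ofComplex w)`. [folklore] -/
def fC (w : ℂ) : ℂ := fΔE4 (ofComplex w)

/-- Auxiliary step `hasDerivAt_M₀` of the Eichler-integral construction. [folklore] -/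
theorem hasDerivAt_M₀ {w : ℂ} (hw : a₀ < w.im) : HasDerivAt M₀ (-(fC w)) w := by
  have h : 0 < (w - (a₀ : ℂ) * Complex.I).im := by simp; linarith
  have := (hasDerivAt_Pk 0 h).comp w ((hasDerivAt_id w).sub_const ((a₀ : ℂ) * Complex.I))
  refine (this.congr_of_eventuallyEq (Eventually.of_forall fun u => rfl)).congr_deriv ?_
  rw [φρ_ofComplex_sub hw, fC]; simp

/-- Auxiliary step `hasDerivAt_M₁` of the Eichler-integral construction. [folklore] -/
theorem hasDerivAt_M₁ {w : ℂ} (hw : a₀ < w.im) : HasDerivAt M₁ (-(fC w * w)) w := by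
  have h : 0 < (w - (a₀ : ℂ) * Complex.I).im := by simp; linarith
  have hs := (hasDerivAt_id w).sub_const ((a₀ : ℂ) * Complex.I)
  have h1 := (hasDerivAt_Pk 1 h).comp w hs
  have h0 := ((hasDerivAt_Pk 0 h).comp w hs).const_mul ((a₀ : ℂ) * Complex.I)
  have := h1.add h0
  refine (this.congr_of_eventuallyEq (Eventually.of_forall fun u => rfl)).congr_deriv ?_
  rw [φρ_ofComplex_sub hw, fC]; simp; ring

/-- Auxiliary step `hasDerivAt_M₂` of the Eichler-integral construction. [folklore] -/
theorem hasDerivAt_M₂ {w : ℂ} (hw : a₀ < w.im) : HasDerivAt M₂ (-(fC w * w ^ 2)) w := by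
  have h : 0 < (w - (a₀ : ℂ) * Complex.I).im := by simp; linarith
  have hs := (hasDerivAt_id w).sub_const ((a₀ : ℂ) * Complex.I)
  have h2 := (hasDerivAt_Pk 2 h).comp w hs
  have h1 := ((hasDerivAt_Pk 1 h).comp w hs).const_mul (2 * ((a₀ : ℂ) * Complex.I))
  have h0 := ((hasDerivAt_Pk 0 h).comp w hs).const_mul (((a₀ : ℂ) * Complex.I) ^ 2)
  have := (h2.add h1).add h0
  refine (this.congr_of_eventuallyEq (Eventually.of_forall fun u => rfl)).congr_deriv ?_
  rw [φρ_ofComplex_sub hw, fC]; simp; ring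

/-- Centered moments `A₁(w) = ∫_w^{i∞} f(ζ)(ζ − w) dζ`. [folklore] -/
def A₁ (w : ℂ) : ℂ := M₁ w - w * M₀ w
/-- `A₂(w) = ∫_w^{i∞} f(ζ)(ζ − w)² dζ`. [folklore] -/
def A₂ (w : ℂ) : ℂ := M₂ w - 2 * w * M₁ w + w ^ 2 * M₀ w

/-- Auxiliary step `hasDerivAt_A₁` of the Eichler-integral construction. [folklore] -/
theorem hasDerivAt_A₁ {w : ℂ} (hw : a₀ < w.im) : HasDerivAt A₁ (-(M₀ w)) w := by
  have := (hasDerivAt_M₁ hw).sub ((hasDerivAt_id w).mul (hasDerivAt_M₀ hw))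
  refine (this.congr_of_eventuallyEq (Eventually.of_forall fun u => rfl)).congr_deriv ?_
  simp; ring

/-- Auxiliary step `hasDerivAt_A₂` of the Eichler-integral construction. [folklore] -/
theorem hasDerivAt_A₂ {w : ℂ} (hw : a₀ < w.im) : HasDerivAt A₂ (-(2 * A₁ w)) w := by
  have h1 := ((hasDerivAt_id w).const_mul 2).mul (hasDerivAt_M₁ hw)
  have h0 := ((hasDerivAt_id w).pow 2).mul (hasDerivAt_M₀ hw)
  have := ((hasDerivAt_M₂ hw).sub h1).add h0
  refine (this.congr_of_eventuallyEq (Eventually.of_forall fun u => rfl)).congr_deriv ?_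
  simp [A₁]; ring

/-! ## 4. The lens `U ∩ SU` and the `S`-identities -/

/-- The lens `L = {w : Im w > a₀, Im(−1/w) > a₀}` (both `w` and `Sw = −1/w` above the pole height). [folklore] -/
def lens : Set ℂ := {w : ℂ | a₀ < w.im ∧ a₀ * Complex.normSq w < w.im}

/-- Auxiliary step `im_neg_inv` of the Eichler-integral construction. [folklore] -/
theorem im_neg_inv (w : ℂ) : (-w⁻¹).im = w.im / Complex.normSq w := by
  simp [Complex.inv_im, neg_div]

/-- Auxiliary step `mem_lens_iff` of the Eichler-integral construction. [folklore] -/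
theorem mem_lens_iff {w : ℂ} : w ∈ lens ↔ a₀ < w.im ∧ a₀ < (-w⁻¹).im := by
  rw [lens, Set.mem_setOf_eq, im_neg_inv]
  constructor
  · rintro ⟨h1, h2⟩
    have hn : 0 < Complex.normSq w := Complex.normSq_pos.mpr (by
      rintro rfl; simp at h1; linarith [a₀_pos])
    exact ⟨h1, by rwa [lt_div_iff₀ hn]⟩
  · rintro ⟨h1, h2⟩
    have hn : 0 < Complex.normSq w := Complex.normSq_pos.mpr (by
      rintro rfl; simp at h1; linarith [a₀_pos])
    exact ⟨h1, by rwa [lt_div_iff₀ hn] at h2⟩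

/-- Auxiliary step `isOpen_lens` of the Eichler-integral construction. [folklore] -/
theorem isOpen_lens : IsOpen lens := by
  have h1 : IsOpen {w : ℂ | a₀ < w.im} := isOpen_lt continuous_const Complex.continuous_im
  have h2 : IsOpen {w : ℂ | a₀ * Complex.normSq w < w.im} :=
    isOpen_lt (continuous_const.mul Complex.continuous_normSq) Complex.continuous_im
  exact h1.inter h2

/-- `normSq` is convex (the parallelogram defect is `t(1−t)|w₁ − w₂|² ≥ 0`). [folklore] -/
theorem normSq_convex_combo (w₁ w₂ : ℂ) (t : ℝ) :
    t * Complex.normSq w₁ + (1 - t) * Complex.normSq w₂ -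
      Complex.normSq ((t : ℂ) * w₁ + ((1 - t : ℝ) : ℂ) * w₂) =
      t * (1 - t) * Complex.normSq (w₁ - w₂) := by
  simp only [Complex.normSq_apply, Complex.add_re, Complex.mul_re, Complex.ofReal_re,
    Complex.ofReal_im, zero_mul, sub_zero, Complex.add_im, Complex.mul_im, add_zero,
    Complex.sub_re, Complex.sub_im]
  ring

/-- **The lens is convex.** [folklore] -/
theorem convex_lens : Convex ℝ lens := by
  rw [convex_iff_forall_pos]
  intro w₁ hw₁ w₂ hw₂ s t hs ht hst
  obtain ⟨h1a, h1b⟩ := hw₁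
  obtain ⟨h2a, h2b⟩ := hw₂
  have ht' : t = 1 - s := by linarith
  subst ht'
  refine ⟨?_, ?_⟩
  · simp only [Complex.add_im, Complex.real_smul, Complex.mul_im, Complex.ofReal_re,
      Complex.ofReal_im, zero_mul, add_zero]
    nlinarith
  · have hid := normSq_convex_combo w₁ w₂ s
    have hnn : 0 ≤ s * (1 - s) * Complex.normSq (w₁ - w₂) :=
      mul_nonneg (mul_nonneg hs.le ht.le) (Complex.normSq_nonneg _)
    simp only [Complex.add_im, Complex.real_smul, Complex.mul_im, Complex.ofReal_re,
      Complex.ofReal_im, zero_mul, add_zero]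
    have e : (s : ℂ) * w₁ + ((1 - s : ℝ) : ℂ) * w₂ = (s : ℂ) * w₁ + (((1:ℝ) - s : ℝ) : ℂ) * w₂ := rfl
    calc a₀ * Complex.normSq ((s : ℂ) * w₁ + ((1 - s : ℝ) : ℂ) * w₂)
        ≤ a₀ * (s * Complex.normSq w₁ + (1 - s) * Complex.normSq w₂) := by
          apply mul_le_mul_of_nonneg_left _ a₀_pos.le; linarith
      _ = s * (a₀ * Complex.normSq w₁) + (1 - s) * (a₀ * Complex.normSq w₂) := by ring
      _ < s * w₁.im + (1 - s) * w₂.im := by nlinarith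

/-- Auxiliary step `I_mem_lens` of the Eichler-integral construction. [folklore] -/
theorem I_mem_lens : Complex.I ∈ lens := by
  refine ⟨by simpa using a₀_lt_one, ?_⟩
  simp [Complex.normSq_I]; exact a₀_lt_one

/-- `S` as a map of `ℂ`: `Sc w = −1/w`. [folklore] -/
def Sc (w : ℂ) : ℂ := -w⁻¹

/-- Auxiliary step `hasDerivAt_Sc` of the Eichler-integral construction. [folklore] -/
theorem hasDerivAt_Sc {w : ℂ} (hw : w ≠ 0) : HasDerivAt Sc (w ^ 2)⁻¹ w := by
  have h := (hasDerivAt_inv hw).fun_neg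
  exact (h.congr_of_eventuallyEq (Eventually.of_forall fun u => rfl)).congr_deriv (by ring)

/-- Auxiliary step `lens_ne_zero` of the Eichler-integral construction. [folklore] -/
theorem lens_ne_zero {w : ℂ} (hw : w ∈ lens) : w ≠ 0 := by
  rintro rfl; have := hw.1; simp at this; linarith [a₀_pos]

/-- Auxiliary step `lens_im_pos` of the Eichler-integral construction. [folklore] -/
theorem lens_im_pos {w : ℂ} (hw : w ∈ lens) : 0 < w.im := a₀_pos.trans hw.1

/-- Auxiliary step `Sc_im` of the Eichler-integral construction. [folklore] -/
theorem Sc_im {w : ℂ} (hw : w ∈ lens) : a₀ < (Sc w).im := (mem_lens_iff.mp hw).2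

/-- `ofComplex (−1/w) = S • ofComplex w` for `Im w > 0`. [folklore] -/
theorem ofComplex_Sc {w : ℂ} (hw : 0 < w.im) :
    ofComplex (Sc w) = ModularGroup.S • ofComplex w := by
  have hS : 0 < (Sc w).im := by
    rw [Sc, im_neg_inv]; exact div_pos hw (Complex.normSq_pos.mpr (by rintro rfl; simp at hw))
  apply UpperHalfPlane.ext
  rw [ofComplex_apply_of_im_pos hS, UpperHalfPlane.modular_S_smul]
  simp [Sc, ofComplex_apply_of_im_pos hw, inv_neg]

/-- **`f(−1/w) = w⁴ f(w)`** on `ℂ` (`Im w > 0`). [folklore] -/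
theorem fC_Sc {w : ℂ} (hw : 0 < w.im) : fC (Sc w) = w ^ 4 * fC w := by
  rw [fC, fC, ofComplex_Sc hw, fΔE4_S_smul, ofComplex_apply_of_im_pos hw]

/-- **(I₀)** `M₀(−1/w) − M₂(w)` is constant on the lens: its derivative vanishes
(`d/dw M₀(−1/w) = −f(−1/w)/w² = −w² f(w) = d/dw M₂(w)`). [folklore] -/
theorem hasDerivAt_I₀ {w : ℂ} (hw : w ∈ lens) :
    HasDerivAt (fun w => M₀ (Sc w) - M₂ w) 0 w := by
  have hw0 := lens_ne_zero hw
  have h1 := (hasDerivAt_M₀ (Sc_im hw)).comp w (hasDerivAt_Sc hw0)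
  have h2 := hasDerivAt_M₂ hw.1
  have := h1.sub h2
  refine (this.congr_of_eventuallyEq (Eventually.of_forall fun u => rfl)).congr_deriv ?_
  rw [fC_Sc (lens_im_pos hw)]
  field_simp
  ring

/-- The constant `c₂ := M₂(i) − M₀(i)` (`= ∫₀^{i∞} f ζ² dζ`, though only its defining property is used). [folklore] -/
def c₂ : ℂ := M₂ Complex.I - M₀ Complex.I

/-- Auxiliary step `Sc_I` of the Eichler-integral construction. [folklore] -/
theorem Sc_I : Sc Complex.I = Complex.I := by simp [Sc, Complex.inv_I]

/-- **(I₀) on the lens**: `M₀(−1/w) = M₂(w) − c₂`. [folklore] -/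
theorem M₀_Sc {w : ℂ} (hw : w ∈ lens) : M₀ (Sc w) = M₂ w - c₂ := by
  have h := IsOpen.is_const_of_deriv_eq_zero (f := fun w => M₀ (Sc w) - M₂ w) isOpen_lens
    convex_lens.isPreconnected
    (fun u hu => (hasDerivAt_I₀ hu).differentiableAt.differentiableWithinAt)
    (fun u hu => (hasDerivAt_I₀ hu).deriv) hw I_mem_lens
  simp only [Sc_I] at h
  rw [c₂]; linear_combination h

/-- The constant `c₁` fixed by (I₁) at `w = i`. [folklore] -/
def c₁ : ℂ := A₁ Complex.I - (M₂ Complex.I - c₂) / Complex.I + M₁ Complex.I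

/-- **(I₁)**: `H₁(w) := A₁(−1/w) − (M₂ w − c₂)/w + (M₁ w − c₁)` has zero derivative on the lens
(using (I₀) for `A₁' ∘ S`). [folklore] -/
theorem hasDerivAt_I₁ {w : ℂ} (hw : w ∈ lens) :
    HasDerivAt (fun w => A₁ (Sc w) - (M₂ w - c₂) / w + (M₁ w - c₁)) 0 w := by
  have hw0 := lens_ne_zero hw
  have h1 := (hasDerivAt_A₁ (Sc_im hw)).comp w (hasDerivAt_Sc hw0)
  have h2 := ((hasDerivAt_M₂ hw.1).sub_const c₂).div (hasDerivAt_id w) hw0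
  have h3 := (hasDerivAt_M₁ hw.1).sub_const c₁
  have := (h1.sub h2).add h3
  refine (this.congr_of_eventuallyEq (Eventually.of_forall fun u => rfl)).congr_deriv ?_
  simp only [id]
  rw [M₀_Sc hw]
  field_simp
  ring

/-- **(I₁) on the lens**: `A₁(−1/w) = ((M₂ w − c₂) − w (M₁ w − c₁))/w`. [folklore] -/
theorem A₁_Sc {w : ℂ} (hw : w ∈ lens) :
    A₁ (Sc w) = ((M₂ w - c₂) - w * (M₁ w - c₁)) / w := by
  have h := IsOpen.is_const_of_deriv_eq_zero
    (f := fun w => A₁ (Sc w) - (M₂ w - c₂) / w + (M₁ w - c₁)) isOpen_lens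
    convex_lens.isPreconnected
    (fun u hu => (hasDerivAt_I₁ hu).differentiableAt.differentiableWithinAt)
    (fun u hu => (hasDerivAt_I₁ hu).deriv) hw I_mem_lens
  simp only [Sc_I] at h
  have h0 : A₁ Complex.I - (M₂ Complex.I - c₂) / Complex.I + (M₁ Complex.I - c₁) = 0 := by
    rw [c₁]; ring
  rw [h0] at h
  have hw0 := lens_ne_zero hw
  have e : ((M₂ w - c₂) - w * (M₁ w - c₁)) / w = (M₂ w - c₂) / w - (M₁ w - c₁) := by
    field_simp
  rw [e]
  linear_combination h

/-- The constant `c₀` fixed by (I₂) at `w = i`. [folklore] -/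
def c₀ : ℂ := -A₂ Complex.I - (M₂ Complex.I - c₂) + 2 * Complex.I * (M₁ Complex.I - c₁) + M₀ Complex.I

/-- **(I₂)**: `H₂(w) := A₂(−1/w) − ((M₂ w − c₂) − 2w(M₁ w − c₁) + w²(M₀ w − c₀))/w²` has zero
derivative on the lens (using (I₁) for `A₂' ∘ S = −2A₁ ∘ S`). [folklore] -/
theorem hasDerivAt_I₂ {w : ℂ} (hw : w ∈ lens) :
    HasDerivAt (fun w => A₂ (Sc w) -
      ((M₂ w - c₂) - 2 * w * (M₁ w - c₁) + w ^ 2 * (M₀ w - c₀)) / w ^ 2) 0 w := by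
  have hw0 := lens_ne_zero hw
  have h1 := (hasDerivAt_A₂ (Sc_im hw)).comp w (hasDerivAt_Sc hw0)
  have hB := (((hasDerivAt_M₂ hw.1).sub_const c₂).fun_sub
    (((hasDerivAt_id' w).const_mul 2).fun_mul ((hasDerivAt_M₁ hw.1).sub_const c₁))).fun_add
    ((hasDerivAt_pow 2 w).fun_mul ((hasDerivAt_M₀ hw.1).sub_const c₀))
  have h2 := hB.fun_div (hasDerivAt_pow 2 w) (pow_ne_zero 2 hw0)
  have := h1.fun_sub h2
  refine (this.congr_of_eventuallyEq (Eventually.of_forall fun u => rfl)).congr_deriv ?_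
  rw [A₁_Sc hw]
  field_simp
  ring

/-- **(I₂) on the lens**: `A₂(−1/w) = ((M₂ w − c₂) − 2w(M₁ w − c₁) + w²(M₀ w − c₀))/w²`. [folklore] -/
theorem A₂_Sc {w : ℂ} (hw : w ∈ lens) :
    A₂ (Sc w) = ((M₂ w - c₂) - 2 * w * (M₁ w - c₁) + w ^ 2 * (M₀ w - c₀)) / w ^ 2 := by
  have h := IsOpen.is_const_of_deriv_eq_zero
    (f := fun w => A₂ (Sc w) - ((M₂ w - c₂) - 2 * w * (M₁ w - c₁) + w ^ 2 * (M₀ w - c₀)) / w ^ 2)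
    isOpen_lens convex_lens.isPreconnected
    (fun u hu => (hasDerivAt_I₂ hu).differentiableAt.differentiableWithinAt)
    (fun u hu => (hasDerivAt_I₂ hu).deriv) hw I_mem_lens
  simp only [Sc_I] at h
  have h0 : A₂ Complex.I - ((M₂ Complex.I - c₂) - 2 * Complex.I * (M₁ Complex.I - c₁) +
      Complex.I ^ 2 * (M₀ Complex.I - c₀)) / Complex.I ^ 2 = 0 := by
    rw [c₀, Complex.I_sq]; ring
  rw [h0] at h
  linear_combination h

/-! ## 5. Periodicity of the centered moments and the function `Fbase` -/

/-- Auxiliary step `Pk0_add_one` of the Eichler-integral construction. [folklore] -/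
theorem Pk0_add_one (τ : ℂ) : Pk 0 (τ + 1) = Pk 0 τ := by
  have := isCuspFunction_φρ.periodic_eichlerPrimitive τ
  simpa [Pk] using this

/-- Auxiliary step `Pk1_add_one` of the Eichler-integral construction. [folklore] -/
theorem Pk1_add_one {τ : ℂ} (hτ : 0 < τ.im) : Pk 1 (τ + 1) = Pk 1 τ + Pk 0 τ := by
  have hτ' : 0 < (τ + 1).im := by simpa using hτ
  have hE := isCuspFunction_φρ.primitive.periodic_eichlerPrimitive τ
  have hP := isCuspFunction_φρ.periodic_eichlerPrimitive τ
  simp only [Function.comp_apply, Complex.ofReal_one] at hE hP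
  simp only [Pk, powPrimitive_succ, powPrimitive_zero, ofComplex_apply_of_im_pos hτ,
    ofComplex_apply_of_im_pos hτ']
  rw [← ofComplex_apply_of_im_pos hτ, ← ofComplex_apply_of_im_pos hτ', hE, hP]
  push_cast; ring

/-- Auxiliary step `Pk2_add_one` of the Eichler-integral construction. [folklore] -/
theorem Pk2_add_one {τ : ℂ} (hτ : 0 < τ.im) : Pk 2 (τ + 1) = Pk 2 τ + 2 * Pk 1 τ + Pk 0 τ := by
  have hτ' : 0 < (τ + 1).im := by simpa using hτ
  have hP := isCuspFunction_φρ.periodic_eichlerPrimitive τ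
  have hE := isCuspFunction_φρ.primitive.periodic_eichlerPrimitive τ
  have hE3 := isCuspFunction_φρ.primitive.primitive.periodic_eichlerPrimitive τ
  simp only [Function.comp_apply, Complex.ofReal_one] at hE hP hE3
  simp only [Pk, powPrimitive_succ, powPrimitive_zero, ofComplex_apply_of_im_pos hτ,
    ofComplex_apply_of_im_pos hτ']
  rw [← ofComplex_apply_of_im_pos hτ, ← ofComplex_apply_of_im_pos hτ', hE, hP, hE3]
  push_cast; ring

/-- Auxiliary step `M₀_add_one` of the Eichler-integral construction. [folklore] -/
theorem M₀_add_one (w : ℂ) : M₀ (w + 1) = M₀ w := by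
  rw [M₀, M₀, show w + 1 - (a₀ : ℂ) * Complex.I = (w - (a₀ : ℂ) * Complex.I) + 1 by ring, Pk0_add_one]

/-- Auxiliary step `M₁_add_one` of the Eichler-integral construction. [folklore] -/
theorem M₁_add_one {w : ℂ} (hw : a₀ < w.im) : M₁ (w + 1) = M₁ w + M₀ w := by
  have h : 0 < (w - (a₀ : ℂ) * Complex.I).im := by simp; linarith
  rw [M₁, M₁, M₀, show w + 1 - (a₀ : ℂ) * Complex.I = (w - (a₀ : ℂ) * Complex.I) + 1 by ring,
    Pk1_add_one h, Pk0_add_one]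
  ring

/-- Auxiliary step `M₂_add_one` of the Eichler-integral construction. [folklore] -/
theorem M₂_add_one {w : ℂ} (hw : a₀ < w.im) : M₂ (w + 1) = M₂ w + 2 * M₁ w + M₀ w := by
  have h : 0 < (w - (a₀ : ℂ) * Complex.I).im := by simp; linarith
  rw [M₂, M₂, M₁, M₀, show w + 1 - (a₀ : ℂ) * Complex.I = (w - (a₀ : ℂ) * Complex.I) + 1 by ring,
    Pk2_add_one h, Pk1_add_one h, Pk0_add_one]
  ring

/-- **`A₁`, `A₂` are `1`-periodic** (centered moments). [folklore] -/
theorem A₁_add_one {w : ℂ} (hw : a₀ < w.im) : A₁ (w + 1) = A₁ w := by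
  rw [A₁, A₁, M₁_add_one hw, M₀_add_one w]; ring

/-- Auxiliary step `A₂_add_one` of the Eichler-integral construction. [folklore] -/
theorem A₂_add_one {w : ℂ} (hw : a₀ < w.im) : A₂ (w + 1) = A₂ w := by
  rw [A₂, A₂, M₂_add_one hw, M₁_add_one hw, M₀_add_one w]; ring

/-- The two constants in closed form: `c₁ = 2M₁(i)`, `c₀ = −c₂`. [folklore] -/
theorem c₁_eq : c₁ = 2 * M₁ Complex.I := by
  rw [c₁, c₂, A₁]
  have hI : Complex.I ≠ 0 := Complex.I_ne_zero
  field_simp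
  ring_nf
  rw [Complex.I_sq]; ring

/-- Auxiliary step `c₀_eq` of the Eichler-integral construction. [folklore] -/
theorem c₀_eq : c₀ = -c₂ := by
  rw [c₀, c₁_eq, c₂, A₂]
  ring_nf
  rw [Complex.I_sq]; ring

/-- `λ := Im c₀`, the coefficient of `1/y`. [folklore] -/
def lam : ℝ := c₀.im

/-- `u(w) := A₂(w) + 2i·Im(w)·A₁(w)` (`= ∫_w^{i∞} f(ζ)(ζ − w)(ζ − w̄) dζ`). [folklore] -/
def uC (w : ℂ) : ℂ := A₂ w + 2 * Complex.I * (w.im : ℂ) * A₁ w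

/-- **The candidate Green function on `Im w > a₀`**: `Fbase(w) = Im A₂(w)/y + 2 Re A₁(w) + λ/y =
Re(−i u(w))/y + λ/y`. [folklore] -/
def Fbase (w : ℂ) : ℝ := (A₂ w).im / w.im + 2 * (A₁ w).re + lam / w.im

/-- Auxiliary step `uC_im` of the Eichler-integral construction. [folklore] -/
theorem uC_im (w : ℂ) : (uC w).im = (A₂ w).im + 2 * w.im * (A₁ w).re := by
  rw [uC]
  simp only [Complex.add_im, Complex.mul_im, Complex.mul_re, Complex.I_re, Complex.I_im,
    Complex.ofReal_re, Complex.ofReal_im, Complex.re_ofNat, Complex.im_ofNat]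
  ring

/-- Auxiliary step `Fbase_eq` of the Eichler-integral construction. [folklore] -/
theorem Fbase_eq (w : ℂ) (hw : 0 < w.im) : Fbase w = ((uC w).im + lam) / w.im := by
  rw [Fbase, uC_im]
  field_simp

/-- `Fbase` is `1`-periodic. [folklore] -/
theorem Fbase_add_one {w : ℂ} (hw : a₀ < w.im) : Fbase (w + 1) = Fbase w := by
  rw [Fbase, Fbase, A₂_add_one hw, A₁_add_one hw]
  simp

/-- The key complex identity behind `S`-invariance:
`|w|²·u(−1/w) = u(w) − c₂ + 2c₁·Re w − c₀|w|²` on the lens. [folklore] -/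
theorem normSq_mul_uC_Sc {w : ℂ} (hw : w ∈ lens) :
    (Complex.normSq w : ℂ) * uC (Sc w) = uC w - c₂ + 2 * c₁ * (w.re : ℂ) - c₀ * Complex.normSq w := by
  have hw0 := lens_ne_zero hw
  have hA2 := A₂_Sc hw
  have hA1 := A₁_Sc hw
  have hSim : ((Sc w).im : ℂ) = (w.im : ℂ) / Complex.normSq w := by
    rw [Sc, im_neg_inv]; push_cast; rfl
  rw [uC, uC, hA2, hA1, hSim]
  have hn : (Complex.normSq w : ℂ) = w * (starRingEnd ℂ) w := (Complex.mul_conj w).symm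
  have hn0 : (Complex.normSq w : ℂ) ≠ 0 := by exact_mod_cast (Complex.normSq_pos.mpr hw0).ne'
  have hc0 : (starRingEnd ℂ) w ≠ 0 := (map_ne_zero (starRingEnd ℂ)).mpr hw0
  -- express everything through `w`, `conj w`, using `conj w = 2 Re w - w` and `2i Im w = w - conj w`
  have hre : ((w.re : ℂ)) = (w + (starRingEnd ℂ) w) / 2 := by
    rw [Complex.add_conj]; push_cast; ring
  have him : ((w.im : ℂ)) = (w - (starRingEnd ℂ) w) / (2 * Complex.I) := by
    rw [Complex.sub_conj]; push_cast; field_simp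
  rw [A₂, A₁] at *
  rw [hre, him, hn]
  field_simp
  ring

/-- **`S`-invariance of `Fbase` on the lens**, granted that `M₁(i)` is real (`f` is real on the
imaginary axis). [folklore] -/
theorem Fbase_Sc {w : ℂ} (hw : w ∈ lens) (hreal : (M₁ Complex.I).im = 0) : Fbase (Sc w) = Fbase w := by
  have hw0 := lens_ne_zero hw
  have hy := lens_im_pos hw
  have hn := Complex.normSq_pos.mpr hw0
  have hSy : (Sc w).im = w.im / Complex.normSq w := by rw [Sc, im_neg_inv]
  have hSy0 : 0 < (Sc w).im := by rw [hSy]; exact div_pos hy hn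
  rw [Fbase_eq _ hSy0, Fbase_eq _ hy, hSy]
  have key := normSq_mul_uC_Sc hw
  have hc1 : c₁.im = 0 := by rw [c₁_eq]; simp [hreal]
  have hlam : lam = -c₂.im := by rw [lam, c₀_eq]; simp
  -- imaginary parts of `key`
  have him := congrArg Complex.im key
  have e1 : ((Complex.normSq w : ℂ) * uC (Sc w)).im = Complex.normSq w * (uC (Sc w)).im := by
    simp [Complex.mul_im]
  have e2 : (uC w - c₂ + 2 * c₁ * (w.re : ℂ) - c₀ * (Complex.normSq w : ℂ)).im =
      (uC w).im - c₂.im + 2 * w.re * c₁.im - Complex.normSq w * c₀.im := by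
    simp only [Complex.sub_im, Complex.add_im, Complex.mul_im, Complex.ofReal_re, Complex.ofReal_im,
      Complex.re_ofNat, Complex.im_ofNat, mul_zero, zero_mul, add_zero, zero_add]
    ring
  rw [e1, e2, hc1, c₀_eq, Complex.neg_im] at him
  rw [hlam, div_div_eq_mul_div, eq_div_iff hy.ne', div_mul_cancel₀ _ hy.ne']
  nlinarith [him]

/-! ## 6. `Fbase` is smooth and `y² Δ Fbase = 2 Fbase` on `Im w > a₀` -/

section Calculus

open InnerProductSpace

/-- Second derivative of a line slice as an iterated Fréchet derivative. [folklore] -/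
theorem deriv_deriv_lineSlice {u : ℂ → ℝ} {x : ℂ} (hu : ContDiffAt ℝ 2 u x) (v : ℂ) :
    deriv (deriv fun t : ℝ => u (x + t • v)) 0 = iteratedFDeriv ℝ 2 u x ![v, v] := by
  rw [iteratedFDeriv_two_apply]
  simp only [Matrix.cons_val_zero, Matrix.cons_val_one]
  have h1 : ∀ᶠ y in 𝓝 x, DifferentiableAt ℝ u y := by
    have := hu.eventually (by simp)
    filter_upwards [this] with y hy
    exact hy.differentiableAt (by simp)
  have h2 : DifferentiableAt ℝ (fderiv ℝ u) x := by
    have := hu.fderiv_right (m := 1) (by norm_num)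
    exact this.differentiableAt (by simp)
  set ℓ : ℝ → ℂ := fun t => x + t • v with hℓ
  have hℓd : ∀ t, HasDerivAt ℓ v t := fun t => by
    simpa [hℓ] using ((hasDerivAt_id t).smul_const v).const_add x
  have hℓ0 : ℓ 0 = x := by simp [hℓ]
  have hℓc : ContinuousAt ℓ 0 := (hℓd 0).continuousAt
  have hd1 : deriv (fun t : ℝ => u (ℓ t)) =ᶠ[𝓝 0] fun t => fderiv ℝ u (ℓ t) v := by
    have : ∀ᶠ t in 𝓝 (0:ℝ), DifferentiableAt ℝ u (ℓ t) := by
      apply hℓc.eventually; rw [hℓ0]; exact h1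
    filter_upwards [this] with t ht
    exact (ht.hasFDerivAt.comp_hasDerivAt t (hℓd t)).deriv
  rw [Filter.EventuallyEq.deriv_eq hd1]
  have h3 : HasDerivAt (fun t => fderiv ℝ u (ℓ t) v) (fderiv ℝ (fderiv ℝ u) x v v) 0 := by
    have hc : HasDerivAt (fun t => fderiv ℝ u (ℓ t)) (fderiv ℝ (fderiv ℝ u) x v) 0 :=
      h2.hasFDerivAt.comp_hasDerivAt_of_eq (0:ℝ) (hℓd 0) hℓ0.symm
    exact hc.clm_apply (hasDerivAt_const (0:ℝ) v) |>.congr_deriv (by simp)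
  exact h3.deriv

/-- **The Laplacian on `ℂ` through the two coordinate slices.** [folklore] -/
theorem laplacian_eq_deriv_deriv_slices {u : ℂ → ℝ} {x : ℂ} (hu : ContDiffAt ℝ 2 u x) :
    Δ u x = deriv (deriv fun s : ℝ => u ((s : ℂ) + (x.im : ℂ) * Complex.I)) x.re
      + deriv (deriv fun t : ℝ => u ((x.re : ℂ) + (t : ℂ) * Complex.I)) x.im := by
  have h := laplacian_eq_iteratedFDeriv_complexPlane u
  rw [h]
  dsimp only
  rw [← deriv_deriv_lineSlice hu 1, ← deriv_deriv_lineSlice hu Complex.I]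
  congr 1
  · have : (fun t : ℝ => u (x + t • (1 : ℂ))) = fun t : ℝ =>
        (fun s : ℝ => u ((s : ℂ) + (x.im : ℂ) * Complex.I)) (t + x.re) := by
      funext t; congr 1; apply Complex.ext <;> simp [add_comm]
    rw [this]
    have h2 : deriv (fun t : ℝ => (fun s : ℝ => u ((s : ℂ) + (x.im : ℂ) * Complex.I)) (t + x.re)) =
        fun t => deriv (fun s : ℝ => u ((s : ℂ) + (x.im : ℂ) * Complex.I)) (t + x.re) := by
      funext t
      exact deriv_comp_add_const (fun s : ℝ => u ((s : ℂ) + (x.im : ℂ) * Complex.I)) x.re t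
    rw [h2, deriv_comp_add_const (deriv fun s : ℝ => u ((s : ℂ) + (x.im : ℂ) * Complex.I)) x.re 0,
      zero_add]
  · have : (fun t : ℝ => u (x + t • Complex.I)) = fun t : ℝ =>
        (fun s : ℝ => u ((x.re : ℂ) + (s : ℂ) * Complex.I)) (t + x.im) := by
      funext t; congr 1; apply Complex.ext <;> simp [add_comm]
    rw [this]
    have h2 : deriv (fun t : ℝ => (fun s : ℝ => u ((x.re : ℂ) + (s : ℂ) * Complex.I)) (t + x.im)) =
        fun t => deriv (fun s : ℝ => u ((x.re : ℂ) + (s : ℂ) * Complex.I)) (t + x.im) := by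
      funext t
      exact deriv_comp_add_const (fun s : ℝ => u ((x.re : ℂ) + (s : ℂ) * Complex.I)) x.im t
    rw [h2, deriv_comp_add_const (deriv fun s : ℝ => u ((x.re : ℂ) + (s : ℂ) * Complex.I)) x.im 0,
      zero_add]

/-- Slices of a holomorphic function: `d/ds H(s + iy) = H'`. [folklore] -/
theorem hasDerivAt_xSlice {H : ℂ → ℂ} {H' : ℂ} {s y : ℝ}
    (h : HasDerivAt H H' ((s : ℂ) + (y : ℂ) * Complex.I)) :
    HasDerivAt (fun σ : ℝ => H ((σ : ℂ) + (y : ℂ) * Complex.I)) H' s := by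
  have h1 : HasDerivAt (fun z : ℂ => z + (y : ℂ) * Complex.I) 1 (s : ℂ) :=
    (hasDerivAt_id (s : ℂ)).add_const _
  have h2 := (h.comp (s : ℂ) h1).comp_ofReal
  simpa using h2

/-- `d/dt H(x + it) = i H'`. [folklore] -/
theorem hasDerivAt_ySlice {H : ℂ → ℂ} {H' : ℂ} {x t : ℝ}
    (h : HasDerivAt H H' ((x : ℂ) + (t : ℂ) * Complex.I)) :
    HasDerivAt (fun τ : ℝ => H ((x : ℂ) + (τ : ℂ) * Complex.I)) (H' * Complex.I) t := by
  have h1 : HasDerivAt (fun z : ℂ => (x : ℂ) + z * Complex.I) Complex.I (t : ℂ) := by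
    simpa using ((hasDerivAt_id (t : ℂ)).mul_const Complex.I).const_add (x : ℂ)
  exact (h.comp (t : ℂ) h1).comp_ofReal

/-- Auxiliary step `hasDerivAt_im_part` of the Eichler-integral construction. [folklore] -/
theorem hasDerivAt_im_part {f : ℝ → ℂ} {f' : ℂ} {t : ℝ} (h : HasDerivAt f f' t) :
    HasDerivAt (fun s => (f s).im) f'.im t :=
  (Complex.imCLM.hasFDerivAt).comp_hasDerivAt t h

/-- Auxiliary step `hasDerivAt_re_part` of the Eichler-integral construction. [folklore] -/
theorem hasDerivAt_re_part {f : ℝ → ℂ} {f' : ℂ} {t : ℝ} (h : HasDerivAt f f' t) :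
    HasDerivAt (fun s => (f s).re) f'.re t :=
  (Complex.reCLM.hasFDerivAt).comp_hasDerivAt t h

/-- A function holomorphic on the open half-plane `Im > a` is real-`C^∞` there. [folklore] -/
theorem contDiffAt_real_of_holo {H K : ℂ → ℂ} {a : ℝ} (hH : ∀ z : ℂ, a < z.im → HasDerivAt H (K z) z)
    {w : ℂ} (hw : a < w.im) (n : WithTop ℕ∞) : ContDiffAt ℝ n H w := by
  have hopen : IsOpen {z : ℂ | a < z.im} := isOpen_lt continuous_const Complex.continuous_im
  have hdiff : DifferentiableOn ℂ H {z : ℂ | a < z.im} := fun z hz =>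
    (hH z hz).differentiableAt.differentiableWithinAt
  have han : AnalyticAt ℂ H w := (hdiff.analyticOnNhd hopen) w hw
  exact (han.contDiffAt (n := n)).restrict_scalars ℝ

/-- **Lemma A.** For `H` holomorphic on `Im > a` with `H' = K`, `K' = L`, the function
`g(w) = Im H(w)/Im w` is `C²` and `(Im w)² Δ g = −2 Re K + 2 Im H / Im w` there. [folklore] -/
theorem laplacian_im_div_im {H K L : ℂ → ℂ} {a : ℝ} (ha : 0 ≤ a)
    (hH : ∀ z : ℂ, a < z.im → HasDerivAt H (K z) z) (hK : ∀ z : ℂ, a < z.im → HasDerivAt K (L z) z)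
    {w : ℂ} (hw : a < w.im) :
    ContDiffAt ℝ 2 (fun z : ℂ => (H z).im / z.im) w ∧
      w.im ^ 2 * Δ (fun z : ℂ => (H z).im / z.im) w = -2 * (K w).re + 2 * (H w).im / w.im := by
  have hy : 0 < w.im := ha.trans_lt hw
  have hcd : ContDiffAt ℝ 2 (fun z : ℂ => (H z).im / z.im) w := by
    have h1 : ContDiffAt ℝ 2 (fun z : ℂ => (H z).im) w :=
      (Complex.imCLM.contDiff.contDiffAt).comp w (contDiffAt_real_of_holo hH hw 2)
    exact h1.div Complex.imCLM.contDiff.contDiffAt hy.ne'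
  refine ⟨hcd, ?_⟩
  rw [laplacian_eq_deriv_deriv_slices hcd]
  set x := w.re
  set y := w.im with hydef
  have hw' : (x : ℂ) + (y : ℂ) * Complex.I = w := by
    apply Complex.ext <;> simp [x, hydef]
  have hxs : (fun s : ℝ => (H ((s : ℂ) + (y : ℂ) * Complex.I)).im / ((s : ℂ) + (y : ℂ) * Complex.I).im) =
      fun s : ℝ => (H ((s : ℂ) + (y : ℂ) * Complex.I)).im / y := by
    funext s; simp
  have hys : (fun t : ℝ => (H ((x : ℂ) + (t : ℂ) * Complex.I)).im / ((x : ℂ) + (t : ℂ) * Complex.I).im) =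
      fun t : ℝ => (H ((x : ℂ) + (t : ℂ) * Complex.I)).im / t := by
    funext t; simp
  rw [hxs, hys]
  -- x-slice: first derivative is `(K(s+iy)).im / y` near `x`, second is `(L w).im / y`
  have hx1 : ∀ s : ℝ, HasDerivAt (fun σ : ℝ => (H ((σ : ℂ) + (y : ℂ) * Complex.I)).im / y)
      ((K ((s : ℂ) + (y : ℂ) * Complex.I)).im / y) s := fun s =>
    (hasDerivAt_im_part (hasDerivAt_xSlice (hH _ (by simpa using hw)))).div_const y
  have hx2 : HasDerivAt (fun σ : ℝ => (K ((σ : ℂ) + (y : ℂ) * Complex.I)).im / y)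
      ((L ((x : ℂ) + (y : ℂ) * Complex.I)).im / y) x :=
    (hasDerivAt_im_part (hasDerivAt_xSlice (hK _ (by simpa using hw)))).div_const y
  have hxd : deriv (fun σ : ℝ => (H ((σ : ℂ) + (y : ℂ) * Complex.I)).im / y) =
      fun s : ℝ => (K ((s : ℂ) + (y : ℂ) * Complex.I)).im / y := funext fun s => (hx1 s).deriv
  rw [hxd, hx2.deriv]
  -- y-slice: first derivative near `y`
  have hy1 : ∀ t : ℝ, a < t → HasDerivAt (fun τ : ℝ => (H ((x : ℂ) + (τ : ℂ) * Complex.I)).im / τ)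
      (((K ((x : ℂ) + (t : ℂ) * Complex.I) * Complex.I).im * t
        - (H ((x : ℂ) + (t : ℂ) * Complex.I)).im * 1) / t ^ 2) t := by
    intro t ht
    have ht0 : t ≠ 0 := (ha.trans_lt ht).ne'
    exact (hasDerivAt_im_part (hasDerivAt_ySlice (hH _ (by simpa using ht)))).div
      (hasDerivAt_id t) ht0
  have hyd : deriv (fun τ : ℝ => (H ((x : ℂ) + (τ : ℂ) * Complex.I)).im / τ) =ᶠ[𝓝 y]
      fun t => ((K ((x : ℂ) + (t : ℂ) * Complex.I) * Complex.I).im * t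
        - (H ((x : ℂ) + (t : ℂ) * Complex.I)).im * 1) / t ^ 2 := by
    filter_upwards [Ioi_mem_nhds hw] with t ht
    exact (hy1 t ht).deriv
  -- second derivative of the y-slice at `y`
  have hKre : HasDerivAt (fun t : ℝ => (K ((x : ℂ) + (t : ℂ) * Complex.I) * Complex.I).im)
      ((L ((x : ℂ) + (y : ℂ) * Complex.I) * Complex.I * Complex.I).im) y :=
    hasDerivAt_im_part ((hasDerivAt_ySlice (hK _ (by simpa using hw))).mul_const Complex.I)
  have hHim : HasDerivAt (fun t : ℝ => (H ((x : ℂ) + (t : ℂ) * Complex.I)).im)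
      ((K ((x : ℂ) + (y : ℂ) * Complex.I) * Complex.I).im) y :=
    hasDerivAt_im_part (hasDerivAt_ySlice (hH _ (by simpa using hw)))
  have hy2 := ((hKre.fun_mul (hasDerivAt_id' y)).fun_sub (hHim.mul_const 1)).fun_div
    (hasDerivAt_pow 2 y) (pow_ne_zero 2 hy.ne')
  rw [(hy2.congr_of_eventuallyEq hyd).deriv, hw']
  simp only [Complex.mul_im, Complex.mul_re, Complex.I_re, Complex.I_im, mul_zero, mul_one,
    add_zero, Nat.cast_ofNat]
  field_simp
  ring

/-- **Lemma B.** The real part of a holomorphic function is harmonic: for `h(w) = Re H(w)`,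
`Δ h = 0` (and `h` is `C²`). [folklore] -/
theorem laplacian_re_holo {H K L : ℂ → ℂ} {a : ℝ}
    (hH : ∀ z : ℂ, a < z.im → HasDerivAt H (K z) z) (hK : ∀ z : ℂ, a < z.im → HasDerivAt K (L z) z)
    {w : ℂ} (hw : a < w.im) :
    ContDiffAt ℝ 2 (fun z : ℂ => (H z).re) w ∧ Δ (fun z : ℂ => (H z).re) w = 0 := by
  have hcd : ContDiffAt ℝ 2 (fun z : ℂ => (H z).re) w :=
    (Complex.reCLM.contDiff.contDiffAt).comp w (contDiffAt_real_of_holo hH hw 2)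
  refine ⟨hcd, ?_⟩
  rw [laplacian_eq_deriv_deriv_slices hcd]
  set x := w.re
  set y := w.im with hydef
  have hx1 : ∀ s : ℝ, HasDerivAt (fun σ : ℝ => (H ((σ : ℂ) + (y : ℂ) * Complex.I)).re)
      ((K ((s : ℂ) + (y : ℂ) * Complex.I)).re) s := fun s =>
    hasDerivAt_re_part (hasDerivAt_xSlice (hH _ (by simpa using hw)))
  have hx2 : HasDerivAt (fun σ : ℝ => (K ((σ : ℂ) + (y : ℂ) * Complex.I)).re)
      ((L ((x : ℂ) + (y : ℂ) * Complex.I)).re) x :=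
    hasDerivAt_re_part (hasDerivAt_xSlice (hK _ (by simpa using hw)))
  have hxd : deriv (fun σ : ℝ => (H ((σ : ℂ) + (y : ℂ) * Complex.I)).re) =
      fun s : ℝ => (K ((s : ℂ) + (y : ℂ) * Complex.I)).re := funext fun s => (hx1 s).deriv
  have hy1 : ∀ t : ℝ, a < t → HasDerivAt (fun τ : ℝ => (H ((x : ℂ) + (τ : ℂ) * Complex.I)).re)
      ((K ((x : ℂ) + (t : ℂ) * Complex.I) * Complex.I).re) t := fun t ht =>
    hasDerivAt_re_part (hasDerivAt_ySlice (hH _ (by simpa using ht)))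
  have hyd : deriv (fun τ : ℝ => (H ((x : ℂ) + (τ : ℂ) * Complex.I)).re) =ᶠ[𝓝 y]
      fun t => (K ((x : ℂ) + (t : ℂ) * Complex.I) * Complex.I).re := by
    filter_upwards [Ioi_mem_nhds hw] with t ht
    exact (hy1 t ht).deriv
  have hy2 : HasDerivAt (fun t : ℝ => (K ((x : ℂ) + (t : ℂ) * Complex.I) * Complex.I).re)
      ((L ((x : ℂ) + (y : ℂ) * Complex.I) * Complex.I * Complex.I).re) y :=
    hasDerivAt_re_part ((hasDerivAt_ySlice (hK _ (by simpa using hw))).mul_const Complex.I)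
  rw [hxd, hx2.deriv, (hy2.congr_of_eventuallyEq hyd).deriv]
  simp only [Complex.mul_re, Complex.mul_im, Complex.I_re, Complex.I_im, mul_zero, mul_one,
    add_zero, zero_sub]
  ring

/-- **Lemma C.** `k(w) = c/Im w`: `C²` with `(Im w)² Δ k = 2c/Im w` on `Im w > 0`. [folklore] -/
theorem laplacian_const_div_im (c : ℝ) {w : ℂ} (hw : 0 < w.im) :
    ContDiffAt ℝ 2 (fun z : ℂ => c / z.im) w ∧ w.im ^ 2 * Δ (fun z : ℂ => c / z.im) w = 2 * c / w.im := by
  have hcd : ContDiffAt ℝ 2 (fun z : ℂ => c / z.im) w :=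
    contDiffAt_const.div Complex.imCLM.contDiff.contDiffAt hw.ne'
  refine ⟨hcd, ?_⟩
  rw [laplacian_eq_deriv_deriv_slices hcd]
  simp only [Complex.add_im, Complex.ofReal_im, Complex.mul_im, Complex.ofReal_re, Complex.I_im,
    mul_one, Complex.I_re, mul_zero, add_zero, zero_add]
  -- x-slice is constant
  have hx : deriv (deriv fun s : ℝ => c / w.im) w.re = 0 := by simp
  rw [hx, zero_add]
  have h1 : ∀ t : ℝ, t ≠ 0 → HasDerivAt (fun τ : ℝ => c / τ) (-(c * 1) / t ^ 2) t := fun t ht =>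
    ((hasDerivAt_const t c).fun_div (hasDerivAt_id' t) ht).congr_deriv (by ring)
  have hd : deriv (fun τ : ℝ => c / τ) =ᶠ[𝓝 w.im] fun t => -(c * 1) / t ^ 2 := by
    filter_upwards [Ioi_mem_nhds hw] with t ht
    exact (h1 t (ne_of_gt ht)).deriv
  have h2 : HasDerivAt (fun t : ℝ => -(c * 1) / t ^ 2) (-(-(c * 1) * (2 * w.im)) / (w.im ^ 2) ^ 2) w.im :=
    ((hasDerivAt_const w.im (-(c * 1))).fun_div (hasDerivAt_pow 2 w.im) (pow_ne_zero 2 hw.ne')).congr_deriv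
      (by simp)
  rw [(h2.congr_of_eventuallyEq hd).deriv]
  field_simp

end Calculus

/-- **`Fbase` is `C²` and `(Im w)² Δ Fbase = 2·Fbase` on `Im w > a₀`.** [folklore] -/
theorem laplacian_Fbase {w : ℂ} (hw : a₀ < w.im) :
    ContDiffAt ℝ 2 Fbase w ∧ w.im ^ 2 * Δ Fbase w = 2 * Fbase w := by
  have hy : 0 < w.im := a₀_pos.trans hw
  have hA2 : ∀ z : ℂ, a₀ < z.im → HasDerivAt A₂ (-(2 * A₁ z)) z := fun z hz => hasDerivAt_A₂ hz
  have hA1' : ∀ z : ℂ, a₀ < z.im → HasDerivAt (fun z => -(2 * A₁ z)) (2 * M₀ z) z := fun z hz =>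
    (((hasDerivAt_A₁ hz).const_mul 2).fun_neg).congr_deriv (by ring)
  have hA1 : ∀ z : ℂ, a₀ < z.im → HasDerivAt (fun z => 2 * A₁ z) (-(2 * M₀ z)) z := fun z hz =>
    ((hasDerivAt_A₁ hz).const_mul 2).congr_deriv (by ring)
  have hM0 : ∀ z : ℂ, a₀ < z.im → HasDerivAt (fun z => -(2 * M₀ z)) (2 * fC z) z := fun z hz =>
    (((hasDerivAt_M₀ hz).const_mul 2).fun_neg).congr_deriv (by ring)
  obtain ⟨hc1, hl1⟩ := laplacian_im_div_im a₀_pos.le hA2 hA1' hw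
  obtain ⟨hc2, hl2⟩ := laplacian_re_holo hA1 hM0 hw
  obtain ⟨hc3, hl3⟩ := laplacian_const_div_im lam hy
  have hF : Fbase = (fun z : ℂ => (A₂ z).im / z.im) + (fun z : ℂ => (2 * A₁ z).re) +
      fun z : ℂ => lam / z.im := by
    funext z; simp [Fbase, Complex.mul_re]
  have h12 : ContDiffAt ℝ 2 ((fun z : ℂ => (A₂ z).im / z.im) + fun z : ℂ => (2 * A₁ z).re) w :=
    hc1.add hc2
  refine ⟨?_, ?_⟩
  · rw [hF]; exact h12.add hc3
  · rw [hF, h12.laplacian_add hc3, hc1.laplacian_add hc2]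
    simp only [Pi.add_apply]
    have e2 : (2 * A₁ w).re = 2 * (A₁ w).re := by simp [Complex.mul_re]
    rw [mul_add, mul_add, hl1, hl3, hl2, mul_zero, add_zero, e2]
    simp only [Complex.neg_re, Complex.mul_re, Complex.re_ofNat, Complex.im_ofNat, zero_mul, sub_zero]
    field_simp
    ring

/-! ## 7. Extension to `ℍ`: the `SL₂(ℤ)`-invariant function `Fρ` -/

section Extension

open ModularGroup CongruenceSubgroup
open scoped Modular

/-- `cmRho = 1 +ᵥ ρ` (Mathlib's `ρ = (−1 + i√3)/2`). [folklore] -/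
theorem cmRho_eq : cmRho = (1 : ℝ) +ᵥ UpperHalfPlane.ρ := by
  apply UpperHalfPlane.ext
  rw [UpperHalfPlane.coe_vadd]
  simp [cmRho, UpperHalfPlane.ρ]
  apply Complex.ext
  · simp; norm_num
  · simp

/-- Auxiliary step `cmRho_eq_T_smul` of the Eichler-integral construction. [folklore] -/
theorem cmRho_eq_T_smul : cmRho = ModularGroup.T • UpperHalfPlane.ρ := by
  rw [cmRho_eq, UpperHalfPlane.modular_T_smul]

/-- Auxiliary step `a₀_eq_im_rho` of the Eichler-integral construction. [folklore] -/
theorem a₀_eq_im_rho : a₀ = UpperHalfPlane.ρ.im := by simp [a₀, UpperHalfPlane.ρ]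

/-- Auxiliary step `cmRho_im` of the Eichler-integral construction. [folklore] -/
theorem cmRho_im : cmRho.im = a₀ := by simp [cmRho, a₀]

/-- The orbit of `cmRho` under `Γ₀(1)` consists of the points `γ • ρ`, `γ ∈ SL₂(ℤ)`. [folklore] -/
theorem mem_orbit_cmRho_iff (z : ℍ) :
    z ∈ MulAction.orbit (Gamma0 1) cmRho ↔ ∃ γ : SL(2, ℤ), γ • UpperHalfPlane.ρ = z := by
  rw [MulAction.mem_orbit_iff, cmRho_eq_T_smul]
  constructor
  · rintro ⟨g, hg⟩
    refine ⟨(g : SL(2, ℤ)) * ModularGroup.T, ?_⟩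
    rw [mul_smul]; exact hg
  · rintro ⟨γ, hγ⟩
    refine ⟨⟨γ * ModularGroup.T⁻¹, mem_Gamma0_one _⟩, ?_⟩
    rw [Subgroup.mk_smul, mul_smul, inv_smul_smul]; exact hγ

/-- Points of the orbit of `ρ` have imaginary part `≤ a₀`. [folklore] -/
theorem im_le_a₀_of_mem_orbit {z : ℍ} (hz : z ∈ MulAction.orbit (Gamma0 1) cmRho) : z.im ≤ a₀ := by
  obtain ⟨γ, rfl⟩ := (mem_orbit_cmRho_iff z).mp hz
  rw [a₀]; exact im_smul_rho_le γ

/-- A point of `𝒟` other than the two corners has `Im > a₀ = √3/2`. [folklore] -/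
theorem a₀_lt_im_of_mem_fd {z : ℍ} (hz : z ∈ 𝒟) (h1 : z ≠ UpperHalfPlane.ρ) (h2 : z ≠ cmRho) :
    a₀ < z.im := by
  have h3 := ModularGroup.three_le_four_mul_im_sq_of_mem_fd hz
  have hpos := z.im_pos
  have hge : a₀ ≤ z.im := by
    rw [a₀, div_le_iff₀ two_pos]
    have : Real.sqrt 3 ≤ Real.sqrt ((z.im * 2) ^ 2) := Real.sqrt_le_sqrt (by nlinarith)
    rwa [Real.sqrt_sq (by positivity)] at this
  rcases hge.lt_or_eq with h | h
  · exact h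
  · exfalso
    -- `Im z = √3/2` forces `|Re z| = 1/2`, i.e. a corner
    have hsq : z.im ^ 2 = 3 / 4 := by
      rw [← h, a₀, div_pow, Real.sq_sqrt (by norm_num)]; norm_num
    have hn := hz.1
    rw [Complex.normSq_apply, UpperHalfPlane.coe_re, UpperHalfPlane.coe_im] at hn
    have hre := hz.2
    have hre2 : z.re ^ 2 = 1 / 4 := by
      have : z.re ^ 2 ≤ 1 / 4 := by
        rw [abs_le] at hre; nlinarith
      nlinarith
    have him : z.im = Real.sqrt 3 / 2 := by rw [← h, a₀]
    have hr2 : z.re = -(1 / 2) ∨ z.re = 1 / 2 := by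
      have : (z.re + 1 / 2) * (z.re - 1 / 2) = 0 := by nlinarith
      rcases mul_eq_zero.mp this with h0 | h0
      · left; linarith
      · right; linarith
    rcases hr2 with hr | hr
    · apply h1
      apply UpperHalfPlane.ext; apply Complex.ext
      · simp [UpperHalfPlane.ρ, hr]; norm_num
      · simp [UpperHalfPlane.ρ, him]
    · apply h2
      apply UpperHalfPlane.ext; apply Complex.ext
      · simp [cmRho, hr]
      · simp [cmRho, him]

/-- A point of `𝒟` off the orbit of `ρ` has `Im > a₀`. [folklore] -/
theorem a₀_lt_im_of_mem_fd_of_notMem {z : ℍ} (hz : z ∈ 𝒟)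
    (hno : z ∉ MulAction.orbit (Gamma0 1) cmRho) : a₀ < z.im := by
  refine a₀_lt_im_of_mem_fd hz ?_ ?_
  · rintro rfl
    exact hno ((mem_orbit_cmRho_iff _).mpr ⟨1, one_smul _ _⟩)
  · rintro rfl
    exact hno (MulAction.mem_orbit_self _)

/-- The coercions of the boundary identifications. [folklore] -/
theorem coe_T_smul (z : ℍ) : ((ModularGroup.T • z : ℍ) : ℂ) = (z : ℂ) + 1 := by
  rw [UpperHalfPlane.modular_T_smul, UpperHalfPlane.coe_vadd]; push_cast; ring

/-- Auxiliary step `coe_T_inv_smul` of the Eichler-integral construction. [folklore] -/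
theorem coe_T_inv_smul (z : ℍ) : ((ModularGroup.T⁻¹ • z : ℍ) : ℂ) = (z : ℂ) - 1 := by
  have := UpperHalfPlane.modular_T_zpow_smul z (-1)
  rw [zpow_neg_one] at this
  rw [this, UpperHalfPlane.coe_vadd]; push_cast; ring

/-- Auxiliary step `coe_S_smul` of the Eichler-integral construction. [folklore] -/
theorem coe_S_smul (z : ℍ) : ((ModularGroup.S • z : ℍ) : ℂ) = Sc (z : ℂ) := by
  rw [UpperHalfPlane.modular_S_smul]; simp [Sc, inv_neg]

/-- **Key lemma**: `Fbase` is compatible with all boundary identifications of `𝒟` away from the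
corners: if `z, g•z ∈ 𝒟` and `z` is off the orbit of `ρ`, then `Fbase(g•z) = Fbase(z)`. [folklore] -/
theorem Fbase_smul_of_mem_fd (hreal : (M₁ Complex.I).im = 0) {z : ℍ} {g : SL(2, ℤ)} (hz : z ∈ 𝒟)
    (hg : g • z ∈ 𝒟) (hno : z ∉ MulAction.orbit (Gamma0 1) cmRho) :
    Fbase ((g • z : ℍ) : ℂ) = Fbase (z : ℂ) := by
  have him : a₀ < z.im := a₀_lt_im_of_mem_fd_of_notMem hz hno
  have him' : a₀ < (z : ℂ).im := by simpa using him
  have hzρ : z ≠ UpperHalfPlane.ρ := by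
    rintro rfl; exact hno ((mem_orbit_cmRho_iff _).mpr ⟨1, one_smul _ _⟩)
  have hzρ' : z ≠ (1 : ℝ) +ᵥ UpperHalfPlane.ρ := by
    rw [← cmRho_eq]; rintro rfl; exact hno (MulAction.mem_orbit_self _)
  rcases ModularGroup.cases_of_mem_fd_smul_mem_fd hz hg with h | h | h | h | h | h | h | h | h | h
  · rcases h with rfl | rfl <;> simp
  · obtain ⟨hT, hre⟩ := h
    have e : ((g • z : ℍ) : ℂ) = (z : ℂ) + 1 := by
      rcases hT with rfl | rfl
      · exact coe_T_smul z
      · rw [ModularGroup.SL_neg_smul]; exact coe_T_smul z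
    rw [e, Fbase_add_one him']
  · obtain ⟨hT, hre⟩ := h
    have e : ((g • z : ℍ) : ℂ) = (z : ℂ) - 1 := by
      rcases hT with rfl | rfl
      · exact coe_T_inv_smul z
      · rw [ModularGroup.SL_neg_smul]; exact coe_T_inv_smul z
    rw [e]
    have := Fbase_add_one (w := (z : ℂ) - 1) (by simpa using him)
    rw [sub_add_cancel] at this
    exact this.symm
  · obtain ⟨hS, hnorm⟩ := h
    have e : ((g • z : ℍ) : ℂ) = Sc (z : ℂ) := by
      rcases hS with rfl | rfl
      · exact coe_S_smul z
      · rw [ModularGroup.SL_neg_smul]; exact coe_S_smul z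
    rw [e]
    apply Fbase_Sc _ hreal
    refine ⟨him', ?_⟩
    rw [Complex.normSq_eq_norm_sq, hnorm]; simpa using him'
  all_goals exact absurd h.2 (by first | exact hzρ' | exact hzρ)

/-- A chosen element of `SL₂(ℤ)` moving `z` into `𝒟`. [folklore] -/
def repElt (z : ℍ) : SL(2, ℤ) := Classical.choose (ModularGroup.exists_smul_mem_fd z)

/-- Auxiliary step `repElt_smul_mem` of the Eichler-integral construction. [folklore] -/
theorem repElt_smul_mem (z : ℍ) : repElt z • z ∈ 𝒟 := Classical.choose_spec (ModularGroup.exists_smul_mem_fd z)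

open Classical in
/-- **The extension**: `Fρ z := Fbase(rep z)` for `z` off the orbit of `ρ` (`rep z ∈ 𝒟`), and `0` on
the orbit. [folklore] -/
def Fρ (z : ℍ) : ℝ :=
  if z ∈ MulAction.orbit (Gamma0 1) cmRho then 0 else Fbase ((repElt z • z : ℍ) : ℂ)

/-- Auxiliary step `Fρ_of_notMem` of the Eichler-integral construction. [folklore] -/
theorem Fρ_of_notMem {z : ℍ} (hz : z ∉ MulAction.orbit (Gamma0 1) cmRho) :
    Fρ z = Fbase ((repElt z • z : ℍ) : ℂ) := by
  rw [Fρ, if_neg hz]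

/-- Auxiliary step `smul_mem_orbit_iff'` of the Eichler-integral construction. [folklore] -/
theorem smul_mem_orbit_iff' (γ : SL(2, ℤ)) (z : ℍ) :
    γ • z ∈ MulAction.orbit (Gamma0 1) cmRho ↔ z ∈ MulAction.orbit (Gamma0 1) cmRho := by
  rw [mem_orbit_cmRho_iff, mem_orbit_cmRho_iff]
  constructor
  · rintro ⟨g, hg⟩; exact ⟨γ⁻¹ * g, by rw [mul_smul, hg, inv_smul_smul]⟩
  · rintro ⟨g, hg⟩; exact ⟨γ * g, by rw [mul_smul, hg]⟩

/-- `Fρ` equals `Fbase` at ANY representative in `𝒟` (off the orbit). [folklore] -/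
theorem Fρ_eq_of_smul_mem_fd (hreal : (M₁ Complex.I).im = 0) {z : ℍ}
    (hz : z ∉ MulAction.orbit (Gamma0 1) cmRho) {g : SL(2, ℤ)} (hg : g • z ∈ 𝒟) :
    Fρ z = Fbase ((g • z : ℍ) : ℂ) := by
  rw [Fρ_of_notMem hz]
  have h1 := repElt_smul_mem z
  -- `repElt z • z = (repElt z * g⁻¹) • (g • z)`
  have e : repElt z • z = (repElt z * g⁻¹) • (g • z) := by rw [mul_smul, inv_smul_smul]
  rw [e] at h1 ⊢
  exact Fbase_smul_of_mem_fd hreal hg h1 ((smul_mem_orbit_iff' g z).not.mpr hz)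

/-- **`Fρ` is `SL₂(ℤ)`-invariant.** [folklore] -/
theorem Fρ_smul (hreal : (M₁ Complex.I).im = 0) (γ : SL(2, ℤ)) (z : ℍ) : Fρ (γ • z) = Fρ z := by
  by_cases hz : z ∈ MulAction.orbit (Gamma0 1) cmRho
  · rw [Fρ, Fρ, if_pos hz, if_pos ((smul_mem_orbit_iff' γ z).mpr hz)]
  · have hz' : γ • z ∉ MulAction.orbit (Gamma0 1) cmRho := (smul_mem_orbit_iff' γ z).not.mpr hz
    rw [Fρ_of_notMem hz']
    have hmem : (repElt (γ • z) * γ) • z ∈ 𝒟 := by rw [mul_smul]; exact repElt_smul_mem _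
    rw [Fρ_eq_of_smul_mem_fd hreal hz hmem, mul_smul]

end Extension

section Regularity

open ModularGroup CongruenceSubgroup
open scoped Modular

variable (hreal : (M₁ Complex.I).im = 0)
include hreal

/-- **Local chart**: near a point `u₀ ∈ 𝒟` off the orbit of `ρ`, `Fρ ∘ ofComplex = Fbase`. [folklore] -/
theorem Fρ_ofComplex_eventuallyEq {u₀ : ℍ} (hu₀ : u₀ ∈ 𝒟) (hno : u₀ ∉ MulAction.orbit (Gamma0 1) cmRho) :
    (fun u : ℂ => Fρ (ofComplex u)) =ᶠ[𝓝 (u₀ : ℂ)] Fbase := by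
  have him : a₀ < u₀.im := a₀_lt_im_of_mem_fd_of_notMem hu₀ hno
  have hρ : u₀ ≠ UpperHalfPlane.ρ := by
    rintro rfl; exact hno ((mem_orbit_cmRho_iff _).mpr ⟨1, one_smul _ _⟩)
  have hρ' : u₀ ≠ cmRho := by rintro rfl; exact hno (MulAction.mem_orbit_self _)
  -- it suffices to produce, eventually, a representative `k • u ∈ 𝒟` with the same `Fbase`
  suffices h : ∀ᶠ u in 𝓝 (u₀ : ℂ), a₀ < u.im ∧
      ∃ k : SL(2, ℤ), k • ofComplex u ∈ 𝒟 ∧ Fbase ((k • ofComplex u : ℍ) : ℂ) = Fbase u by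
    filter_upwards [h] with u ⟨hu, k, hk, hF⟩
    have hu0 : 0 < u.im := a₀_pos.trans hu
    have hno' : ofComplex u ∉ MulAction.orbit (Gamma0 1) cmRho := fun hmem => by
      have := im_le_a₀_of_mem_orbit hmem
      rw [← UpperHalfPlane.coe_im, ofComplex_apply_of_im_pos hu0] at this
      linarith
    rw [Fρ_eq_of_smul_mem_fd hreal hno' hk, hF]
  -- continuity facts at `u₀`
  have hc_im : ∀ᶠ u in 𝓝 (u₀ : ℂ), a₀ < u.im :=
    Complex.continuous_im.continuousAt.eventually (lt_mem_nhds (by simpa using him))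
  have hre0 : |u₀.re| ≤ 1 / 2 := hu₀.2
  have hn0 : 1 ≤ Complex.normSq (u₀ : ℂ) := hu₀.1
  -- case split on the position of `u₀`
  by_cases hint : |u₀.re| < 1 / 2 ∧ 1 < Complex.normSq (u₀ : ℂ)
  · -- interior: eventually in `𝒟ᵒ`
    have h1 : ∀ᶠ u in 𝓝 (u₀ : ℂ), |u.re| < 1 / 2 :=
      (continuous_abs.comp Complex.continuous_re).continuousAt.eventually
        (gt_mem_nhds (by simpa using hint.1))
    have h2 : ∀ᶠ u in 𝓝 (u₀ : ℂ), 1 < Complex.normSq u :=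
      Complex.continuous_normSq.continuousAt.eventually (lt_mem_nhds hint.2)
    filter_upwards [hc_im, h1, h2] with u hu h1 h2
    have hu0 : 0 < u.im := a₀_pos.trans hu
    refine ⟨hu, 1, ?_, by simp [ofComplex_apply_of_im_pos hu0]⟩
    rw [one_smul]
    exact ⟨by rw [ofComplex_apply_of_im_pos hu0]; exact h2.le,
      by rw [show (ofComplex u).re = u.re by rw [← UpperHalfPlane.coe_re, ofComplex_apply_of_im_pos hu0]]; exact h1.le⟩
  · push Not at hint
    by_cases hre : |u₀.re| < 1 / 2
    · -- on the arc: `normSq u₀ = 1`, `|re u₀| < 1/2`; use `S` when `normSq u < 1`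
      have hn1 : Complex.normSq (u₀ : ℂ) = 1 := le_antisymm (hint hre) hn0
      have h1 : ∀ᶠ u in 𝓝 (u₀ : ℂ), |u.re| < 1 / 2 :=
        (continuous_abs.comp Complex.continuous_re).continuousAt.eventually
          (gt_mem_nhds (by simpa using hre))
      have h2 : ∀ᶠ u in 𝓝 (u₀ : ℂ), |u.re| < Complex.normSq u / 2 := by
        have hc : Continuous fun u : ℂ => Complex.normSq u / 2 - |u.re| := by fun_prop
        have h0 : 0 < Complex.normSq (u₀ : ℂ) / 2 - |(u₀ : ℂ).re| := by
          rw [hn1, UpperHalfPlane.coe_re]; linarith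
        filter_upwards [hc.continuousAt.eventually (lt_mem_nhds h0)] with u hu
        linarith
      filter_upwards [hc_im, h1, h2] with u hu h1 h2
      have hu0 : 0 < u.im := a₀_pos.trans hu
      have hcoe : ((ofComplex u : ℍ) : ℂ) = u := by rw [ofComplex_apply_of_im_pos hu0]
      refine ⟨hu, ?_⟩
      by_cases hn : 1 ≤ Complex.normSq u
      · refine ⟨1, ?_, by simp [hcoe]⟩
        rw [one_smul]
        exact ⟨by rwa [hcoe], by rw [show (ofComplex u).re = u.re by rw [← UpperHalfPlane.coe_re, hcoe]]; exact h1.le⟩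
      · push Not at hn
        have hnpos : 0 < Complex.normSq u := Complex.normSq_pos.mpr (by rintro rfl; simp at hu0)
        have hlens : u ∈ lens := ⟨hu, by nlinarith [a₀_pos]⟩
        refine ⟨ModularGroup.S, ⟨?_, ?_⟩, ?_⟩
        · -- `normSq (S u) = 1/normSq u ≥ 1`
          rw [coe_S_smul, hcoe, Sc, Complex.normSq_neg, Complex.normSq_inv]
          exact (one_le_inv₀ hnpos).mpr hn.le
        · rw [← UpperHalfPlane.coe_re, coe_S_smul, hcoe, Sc, Complex.neg_re, Complex.inv_re, abs_neg,
            abs_div, abs_of_pos hnpos, div_le_iff₀ hnpos]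
          linarith
        · rw [coe_S_smul, hcoe]
          exact Fbase_Sc hlens hreal
    · -- on a vertical side: `|re u₀| = 1/2`, `normSq u₀ > 1`
      push Not at hre
      have hre12 : |u₀.re| = 1 / 2 := le_antisymm hre0 hre
      have hn1 : 1 < Complex.normSq (u₀ : ℂ) := by
        by_contra hcon
        push Not at hcon
        have hn1 : Complex.normSq (u₀ : ℂ) = 1 := le_antisymm hcon hn0
        -- then `u₀` is a corner
        have him2 : u₀.im ^ 2 = 3 / 4 := by
          rw [Complex.normSq_apply, UpperHalfPlane.coe_re, UpperHalfPlane.coe_im] at hn1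
          have : u₀.re ^ 2 = 1 / 4 := by
            rw [← sq_abs, hre12]; norm_num
          nlinarith
        have hima : u₀.im = a₀ := by
          have hpos := u₀.im_pos
          rw [a₀]
          have : u₀.im = Real.sqrt (u₀.im ^ 2) := (Real.sqrt_sq hpos.le).symm
          rw [this, him2, Real.sqrt_div (by norm_num), show Real.sqrt 4 = 2 by
            rw [show (4:ℝ) = 2^2 by norm_num, Real.sqrt_sq (by norm_num)]]
        exact absurd hima (ne_of_gt him)
      rcases (abs_eq (by norm_num : (0:ℝ) ≤ 1/2)).mp hre12 with hr | hr
      · -- right side `re u₀ = 1/2`: use `T⁻¹` when `re u > 1/2`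
        have h1 : ∀ᶠ u in 𝓝 (u₀ : ℂ), 0 < u.re ∧ u.re < 1 := by
          have e : (u₀ : ℂ).re = 1 / 2 := by rw [UpperHalfPlane.coe_re, hr]
          have ha := Complex.continuous_re.continuousAt.eventually (lt_mem_nhds (show (0:ℝ) < (u₀:ℂ).re by rw [e]; norm_num))
          have hb := Complex.continuous_re.continuousAt.eventually (gt_mem_nhds (show (u₀:ℂ).re < 1 by rw [e]; norm_num))
          exact ha.and hb
        have h2 : ∀ᶠ u in 𝓝 (u₀ : ℂ), 1 < Complex.normSq u :=
          Complex.continuous_normSq.continuousAt.eventually (lt_mem_nhds hn1)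
        have h3 : ∀ᶠ u in 𝓝 (u₀ : ℂ), 1 < Complex.normSq (u - 1) := by
          have hc : Continuous fun u : ℂ => Complex.normSq (u - 1) := by fun_prop
          have h0 : 1 < Complex.normSq ((u₀ : ℂ) - 1) := by
            have e : Complex.normSq ((u₀ : ℂ) - 1) = Complex.normSq (u₀ : ℂ) - 2 * u₀.re + 1 := by
              simp [Complex.normSq_apply]; ring
            rw [e, hr]; linarith
          exact hc.continuousAt.eventually (lt_mem_nhds h0)
        filter_upwards [hc_im, h1, h2, h3] with u hu h1 h2 h3
        have hu0 : 0 < u.im := a₀_pos.trans hu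
        have hcoe : ((ofComplex u : ℍ) : ℂ) = u := by rw [ofComplex_apply_of_im_pos hu0]
        refine ⟨hu, ?_⟩
        by_cases hru : u.re ≤ 1 / 2
        · refine ⟨1, ?_, by simp [hcoe]⟩
          rw [one_smul]
          refine ⟨by rw [hcoe]; exact h2.le, ?_⟩
          rw [show (ofComplex u).re = u.re by rw [← UpperHalfPlane.coe_re, hcoe], abs_le]
          exact ⟨by linarith [h1.1], hru⟩
        · push Not at hru
          refine ⟨ModularGroup.T⁻¹, ⟨?_, ?_⟩, ?_⟩
          · rw [coe_T_inv_smul, hcoe]; exact h3.le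
          · rw [← UpperHalfPlane.coe_re, coe_T_inv_smul, hcoe, Complex.sub_re, Complex.one_re, abs_le]
            exact ⟨by linarith, by linarith [h1.2]⟩
          · rw [coe_T_inv_smul, hcoe]
            have := Fbase_add_one (w := u - 1) (by simpa using hu)
            rw [sub_add_cancel] at this
            exact this.symm
      · -- left side `re u₀ = -1/2`: use `T` when `re u < -1/2`
        have h1 : ∀ᶠ u in 𝓝 (u₀ : ℂ), -1 < u.re ∧ u.re < 0 := by
          have e : (u₀ : ℂ).re = -(1 / 2) := by rw [UpperHalfPlane.coe_re, hr]
          have ha := Complex.continuous_re.continuousAt.eventually (lt_mem_nhds (show (-1:ℝ) < (u₀:ℂ).re by rw [e]; norm_num))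
          have hb := Complex.continuous_re.continuousAt.eventually (gt_mem_nhds (show (u₀:ℂ).re < 0 by rw [e]; norm_num))
          exact ha.and hb
        have h2 : ∀ᶠ u in 𝓝 (u₀ : ℂ), 1 < Complex.normSq u :=
          Complex.continuous_normSq.continuousAt.eventually (lt_mem_nhds hn1)
        have h3 : ∀ᶠ u in 𝓝 (u₀ : ℂ), 1 < Complex.normSq (u + 1) := by
          have hc : Continuous fun u : ℂ => Complex.normSq (u + 1) := by fun_prop
          have h0 : 1 < Complex.normSq ((u₀ : ℂ) + 1) := by
            have e : Complex.normSq ((u₀ : ℂ) + 1) = Complex.normSq (u₀ : ℂ) + 2 * u₀.re + 1 := by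
              simp [Complex.normSq_apply]; ring
            rw [e, hr]; linarith
          exact hc.continuousAt.eventually (lt_mem_nhds h0)
        filter_upwards [hc_im, h1, h2, h3] with u hu h1 h2 h3
        have hu0 : 0 < u.im := a₀_pos.trans hu
        have hcoe : ((ofComplex u : ℍ) : ℂ) = u := by rw [ofComplex_apply_of_im_pos hu0]
        refine ⟨hu, ?_⟩
        by_cases hru : -(1 / 2) ≤ u.re
        · refine ⟨1, ?_, by simp [hcoe]⟩
          rw [one_smul]
          refine ⟨by rw [hcoe]; exact h2.le, ?_⟩
          rw [show (ofComplex u).re = u.re by rw [← UpperHalfPlane.coe_re, hcoe], abs_le]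
          exact ⟨hru, by linarith [h1.2]⟩
        · push Not at hru
          refine ⟨ModularGroup.T, ⟨?_, ?_⟩, ?_⟩
          · rw [coe_T_smul, hcoe]; exact h3.le
          · rw [← UpperHalfPlane.coe_re, coe_T_smul, hcoe, Complex.add_re, Complex.one_re, abs_le]
            exact ⟨by linarith [h1.1], by linarith⟩
          · rw [coe_T_smul, hcoe]
            exact Fbase_add_one hu

omit hreal in
/-- Auxiliary step `det_val_pos` of the Eichler-integral construction. [folklore] -/
theorem det_val_pos (γ : SL(2, ℤ)) : 0 < ((γ : GL (Fin 2) ℝ)).val.det := by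
  rw [← Matrix.GeneralLinearGroup.val_det_apply]; exact det_coe_pos γ

omit hreal in
/-- Auxiliary step `det_val_eq_one` of the Eichler-integral construction. [folklore] -/
theorem det_val_eq_one (γ : SL(2, ℤ)) : ((γ : GL (Fin 2) ℝ)).val.det = 1 := by
  rw [← Matrix.GeneralLinearGroup.val_det_apply]; simp

omit hreal in
/-- The Möbius map of `γ ∈ SL₂(ℤ)` extended to `ℂ`. [folklore] -/
theorem moebius_facts (γ : SL(2, ℤ)) (z : ℍ) :
    (∀ᶠ w in 𝓝 (z : ℂ), DifferentiableAt ℂ (fun w : ℂ => ((γ • ofComplex w : ℍ) : ℂ)) w) ∧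
      deriv (fun w : ℂ => ((γ • ofComplex w : ℍ) : ℂ)) z = 1 / denom (γ : GL (Fin 2) ℝ) z ^ 2 := by
  have hdet := det_val_pos γ
  constructor
  · filter_upwards [isOpen_upperHalfPlaneSet.mem_nhds z.im_pos] with w hw
    have := (UpperHalfPlane.analyticAt_smul hdet ⟨w, hw⟩).differentiableAt
    simpa [ModularGroup.sl_moeb] using this
  · have := UpperHalfPlane.deriv_smul hdet z
    simp only [ModularGroup.sl_moeb]
    rw [this, det_val_eq_one]; simp

/-- **`Fρ` is `C²` and `(Im z)² Δ (Fρ ∘ ofComplex)(z) = 2 Fρ(z)` off the orbit of `ρ`.** [folklore] -/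
theorem contDiffAt_laplacian_Fρ {z : ℍ} (hz : z ∉ MulAction.orbit (Gamma0 1) cmRho) :
    ContDiffAt ℝ 2 (fun w : ℂ => Fρ (ofComplex w)) (z : ℂ) ∧
      realHypLaplacian Fρ z = (2 : ℝ) * ((2 : ℝ) - 1) * Fρ z := by
  set γ := repElt z with hγ
  set u₀ : ℍ := γ • z with hu₀
  have hu₀fd : u₀ ∈ 𝒟 := repElt_smul_mem z
  have hu₀no : u₀ ∉ MulAction.orbit (Gamma0 1) cmRho := (smul_mem_orbit_iff' γ z).not.mpr hz
  have hchart := Fρ_ofComplex_eventuallyEq hreal hu₀fd hu₀no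
  set μ : ℂ → ℂ := fun w => ((γ • ofComplex w : ℍ) : ℂ) with hμ
  obtain ⟨hμdiff, hμderiv⟩ := moebius_facts γ z
  have hμz : μ (z : ℂ) = (u₀ : ℂ) := by simp [hμ, hu₀]
  have hμcont : ContinuousAt μ (z : ℂ) := hμdiff.self_of_nhds.continuousAt
  -- `Fρ ∘ ofComplex = Fbase ∘ μ` near `z`
  have hloc : (fun w : ℂ => Fρ (ofComplex w)) =ᶠ[𝓝 (z : ℂ)] Fbase ∘ μ := by
    have h1 : ∀ᶠ w in 𝓝 (z : ℂ), Fρ (ofComplex (μ w)) = Fbase (μ w) := by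
      have := hμcont.eventually (show ∀ᶠ u in 𝓝 (μ (z : ℂ)), Fρ (ofComplex u) = Fbase u by
        rw [hμz]; exact hchart)
      exact this
    filter_upwards [h1] with w hw
    rw [Function.comp_apply, ← hw, hμ]
    simp only [ofComplex_apply]
    rw [Fρ_smul hreal]
  have him : a₀ < (u₀ : ℂ).im := by simpa using a₀_lt_im_of_mem_fd_of_notMem hu₀fd hu₀no
  obtain ⟨hcd, hlap⟩ := laplacian_Fbase him
  have hμsmooth : ContDiffAt ℝ 2 μ (z : ℂ) := by
    have hdet := det_val_pos γ
    have han := UpperHalfPlane.analyticAt_smul hdet z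
    have : AnalyticAt ℂ μ (z : ℂ) := by simpa [hμ, ModularGroup.sl_moeb] using han
    exact (this.contDiffAt).restrict_scalars ℝ
  refine ⟨?_, ?_⟩
  · refine ContDiffAt.congr_of_eventuallyEq ?_ hloc
    rw [← hμz] at hcd
    exact hcd.comp (z : ℂ) hμsmooth
  · unfold realHypLaplacian
    rw [(InnerProductSpace.laplacian_congr_nhds hloc).eq_of_nhds]
    rw [← hμz] at hcd
    rw [ConformalLaplacian.laplacian_comp_holomorphic hμdiff hcd, hμderiv, smul_eq_mul]
    have hpt : ((γ • ofComplex (z : ℂ) : ℍ) : ℂ) = (u₀ : ℂ) := by simp [hu₀]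
    rw [hpt]
    -- `(Im z)² / |cz+d|⁴ = (Im u₀)²`
    have hden : denom (γ : GL (Fin 2) ℝ) z ≠ 0 := UpperHalfPlane.denom_ne_zero _ z
    have himu : (u₀ : ℂ).im = z.im / Complex.normSq (denom (γ : GL (Fin 2) ℝ) z) := by
      rw [UpperHalfPlane.coe_im, hu₀, ModularGroup.im_smul_eq_div_normSq]
    have hval : Fρ z = Fbase (u₀ : ℂ) := Fρ_eq_of_smul_mem_fd hreal hz hu₀fd
    rw [hval]
    have hnorm : ‖(1 : ℂ) / denom (γ : GL (Fin 2) ℝ) z ^ 2‖ ^ 2 =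
        1 / Complex.normSq (denom (γ : GL (Fin 2) ℝ) z) ^ 2 := by
      rw [norm_div, norm_one, norm_pow, Complex.normSq_eq_norm_sq]; ring
    rw [hnorm]
    have hn0 : Complex.normSq (denom (γ : GL (Fin 2) ℝ) z) ≠ 0 := by
      rwa [Ne, Complex.normSq_eq_zero]
    have e : z.im ^ 2 * (1 / Complex.normSq (denom (γ : GL (Fin 2) ℝ) z) ^ 2 * Δ Fbase (u₀ : ℂ)) =
        (u₀ : ℂ).im ^ 2 * Δ Fbase (u₀ : ℂ) := by
      rw [himu]; field_simp
    rw [e, hlap]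
    norm_num

end Regularity

section CuspBound

open ModularGroup CongruenceSubgroup
open scoped Modular

/-- Exponential decay of the moments on vertical strips: for `|Re w| ≤ 1/2`, `Im w ≥ 2`,
`‖Pk k (w − i a₀)‖ ≤ C (2 + Im w)^k e^{−2π(Im w − a₀)}`. [folklore] -/
theorem exists_norm_Pk_le (k : ℕ) : ∃ C : ℝ, 0 ≤ C ∧ ∀ w : ℂ, |w.re| ≤ 1 / 2 → 2 ≤ w.im →
    ‖Pk k (w - (a₀ : ℂ) * Complex.I)‖ ≤ C * (2 + w.im) ^ k * Real.exp (-(2 * π) * (w.im - a₀)) := by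
  obtain ⟨C, hC0, hC⟩ := isCuspFunction_φρ.exists_norm_powPrimitive_le k
  refine ⟨C, hC0, fun w hre hy => ?_⟩
  have him : (w - (a₀ : ℂ) * Complex.I).im = w.im - a₀ := by simp
  have hpos : 0 < (w - (a₀ : ℂ) * Complex.I).im := by rw [him]; linarith [a₀_lt_one]
  set τ : ℍ := ⟨w - (a₀ : ℂ) * Complex.I, hpos⟩ with hτ
  have hτim : τ.im = w.im - a₀ := by rw [← UpperHalfPlane.coe_im]; exact him
  have hτre : τ.re = w.re := by rw [← UpperHalfPlane.coe_re]; simp [hτ]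
  have h1 : 1 ≤ τ.im := by rw [hτim]; linarith [a₀_lt_one]
  have h := hC τ h1
  rw [Pk, ofComplex_apply_of_im_pos hpos]
  refine h.trans ?_
  rw [hτim, hτre, div_one]
  have hb : (1 + |w.re| + (w.im - a₀)) ^ k ≤ (2 + w.im) ^ k := by
    apply pow_le_pow_left₀ (by linarith [abs_nonneg w.re, a₀_lt_one])
    linarith [a₀_pos]
  have he : 0 ≤ Real.exp (-(2 * π) * (w.im - a₀)) := (Real.exp_pos _).le
  nlinarith [mul_le_mul_of_nonneg_right hb he, hC0, mul_nonneg hC0 he]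

/-- `x⁵ e^{−x} ≤ 120` for `x ≥ 0`. [folklore] -/
theorem pow_five_mul_exp_neg_le {x : ℝ} (hx : 0 ≤ x) : x ^ 5 * Real.exp (-x) ≤ 120 := by
  have h := Real.pow_div_factorial_le_exp x hx 5
  rw [show (Nat.factorial 5 : ℝ) = 120 by norm_num, div_le_iff₀ (by norm_num)] at h
  rw [Real.exp_neg]
  have he := Real.exp_pos x
  rw [mul_inv_le_iff₀ he]
  linarith

set_option maxHeartbeats 800000 in
/-- **Cusp bound**: `|Fbase w| · Im w ≤ C` for `|Re w| ≤ 1/2`, `Im w ≥ 2`. [folklore] -/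
theorem exists_Fbase_cusp_bound : ∃ C : ℝ, ∀ w : ℂ, |w.re| ≤ 1 / 2 → 2 ≤ w.im → |Fbase w| * w.im ≤ C := by
  obtain ⟨C₀, hC₀, h0⟩ := exists_norm_Pk_le 0
  obtain ⟨C₁, hC₁, h1⟩ := exists_norm_Pk_le 1
  obtain ⟨C₂, hC₂, h2⟩ := exists_norm_Pk_le 2
  set K : ℝ := C₀ + C₁ + C₂ with hK
  have hK0 : 0 ≤ K := by rw [hK]; positivity
  have hKC₀ : C₀ ≤ K := by rw [hK]; linarith
  have hKC₁ : C₁ ≤ K := by rw [hK]; linarith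
  have hKC₂ : C₂ ≤ K := by rw [hK]; linarith
  have ha0 : 0 ≤ a₀ := a₀_pos.le
  have ha1 : a₀ ≤ 1 := a₀_lt_one.le
  refine ⟨40 * K * (Real.exp (2 * π * a₀) * (120 * Real.exp 2)) + |lam|, fun w hre hy => ?_⟩
  have hy0 : 0 < w.im := by linarith
  set E : ℝ := Real.exp (-(2 * π) * (w.im - a₀)) with hE
  have hE0 : 0 ≤ E := (Real.exp_pos _).le
  have hP0 := h0 w hre hy
  have hP1 := h1 w hre hy
  have hP2 := h2 w hre hy
  rw [← hE] at hP0 hP1 hP2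
  have hy2 : 1 ≤ 2 + w.im := by linarith
  set B : ℝ := K * (2 + w.im) ^ 2 * E with hB
  have hBnn : 0 ≤ B := by rw [hB]; positivity
  have hsq1 : (1:ℝ) ≤ (2 + w.im) ^ 2 := by exact one_le_pow₀ hy2
  have hsq2 : (2 + w.im) ≤ (2 + w.im) ^ 2 := by nlinarith
  have hB0 : ‖Pk 0 (w - (a₀ : ℂ) * Complex.I)‖ ≤ B := by
    refine hP0.trans ?_
    rw [hB, pow_zero]
    gcongr
  have hB1 : ‖Pk 1 (w - (a₀ : ℂ) * Complex.I)‖ ≤ B := by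
    refine hP1.trans ?_
    rw [hB, pow_one]
    gcongr
  have hB2 : ‖Pk 2 (w - (a₀ : ℂ) * Complex.I)‖ ≤ B := by
    refine hP2.trans ?_
    rw [hB]
    gcongr
  -- norms of `M_j`, `A_j`
  have ha : ‖(a₀ : ℂ) * Complex.I‖ = a₀ := by simp [abs_of_pos a₀_pos]
  have hw : ‖w‖ ≤ 2 + w.im := by
    calc ‖w‖ ≤ |w.re| + |w.im| := Complex.norm_le_abs_re_add_abs_im w
      _ ≤ 2 + w.im := by rw [abs_of_pos hy0]; linarith
  have hM0 : ‖M₀ w‖ ≤ B := hB0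
  have hM1 : ‖M₁ w‖ ≤ 2 * B := by
    rw [M₁]
    calc ‖Pk 1 (w - (a₀:ℂ) * Complex.I) + (a₀:ℂ) * Complex.I * Pk 0 (w - (a₀:ℂ) * Complex.I)‖
        ≤ ‖Pk 1 (w - (a₀:ℂ) * Complex.I)‖ + ‖(a₀:ℂ) * Complex.I‖ * ‖Pk 0 (w - (a₀:ℂ) * Complex.I)‖ := by
          refine (norm_add_le _ _).trans ?_; rw [norm_mul]
      _ ≤ B + a₀ * B := by rw [ha]; gcongr
      _ ≤ 2 * B := by
          have h1 : a₀ * B ≤ 1 * B := mul_le_mul_of_nonneg_right ha1 hBnn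
          linarith
  have hM2 : ‖M₂ w‖ ≤ 4 * B := by
    rw [M₂]
    have e1 : ‖2 * ((a₀:ℂ) * Complex.I) * Pk 1 (w - (a₀:ℂ) * Complex.I)‖ = 2 * a₀ * ‖Pk 1 (w - (a₀:ℂ) * Complex.I)‖ := by
      rw [norm_mul, norm_mul, ha]; simp
    have e2 : ‖((a₀:ℂ) * Complex.I) ^ 2 * Pk 0 (w - (a₀:ℂ) * Complex.I)‖ = a₀ ^ 2 * ‖Pk 0 (w - (a₀:ℂ) * Complex.I)‖ := by
      rw [norm_mul, norm_pow, ha]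
    calc ‖Pk 2 (w - (a₀:ℂ) * Complex.I) + 2 * ((a₀:ℂ) * Complex.I) * Pk 1 (w - (a₀:ℂ) * Complex.I) +
          ((a₀:ℂ) * Complex.I) ^ 2 * Pk 0 (w - (a₀:ℂ) * Complex.I)‖
        ≤ ‖Pk 2 (w - (a₀:ℂ) * Complex.I)‖ + ‖2 * ((a₀:ℂ) * Complex.I) * Pk 1 (w - (a₀:ℂ) * Complex.I)‖ +
          ‖((a₀:ℂ) * Complex.I) ^ 2 * Pk 0 (w - (a₀:ℂ) * Complex.I)‖ := norm_add₃_le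
      _ = ‖Pk 2 (w - (a₀:ℂ) * Complex.I)‖ + 2 * a₀ * ‖Pk 1 (w - (a₀:ℂ) * Complex.I)‖ +
          a₀ ^ 2 * ‖Pk 0 (w - (a₀:ℂ) * Complex.I)‖ := by rw [e1, e2]
      _ ≤ B + 2 * a₀ * B + a₀ ^ 2 * B := by gcongr
      _ ≤ 4 * B := by
          have h1 : a₀ * B ≤ 1 * B := mul_le_mul_of_nonneg_right ha1 hBnn
          have h2 : a₀ ^ 2 * B ≤ 1 * B := mul_le_mul_of_nonneg_right (by nlinarith) hBnn
          linarith
  have hA1 : ‖A₁ w‖ ≤ 2 * B + (2 + w.im) * B := by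
    rw [A₁]
    calc ‖M₁ w - w * M₀ w‖ ≤ ‖M₁ w‖ + ‖w * M₀ w‖ := norm_sub_le _ _
      _ = ‖M₁ w‖ + ‖w‖ * ‖M₀ w‖ := by rw [norm_mul]
      _ ≤ 2 * B + (2 + w.im) * B := by gcongr
  have hA2 : ‖A₂ w‖ ≤ 4 * B + 2 * (2 + w.im) * (2 * B) + (2 + w.im) ^ 2 * B := by
    rw [A₂]
    calc ‖M₂ w - 2 * w * M₁ w + w ^ 2 * M₀ w‖
        ≤ ‖M₂ w‖ + ‖2 * w * M₁ w‖ + ‖w ^ 2 * M₀ w‖ := by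
          refine (norm_add_le _ _).trans (add_le_add (norm_sub_le _ _) le_rfl)
      _ = ‖M₂ w‖ + 2 * ‖w‖ * ‖M₁ w‖ + ‖w‖ ^ 2 * ‖M₀ w‖ := by
          rw [norm_mul, norm_mul, norm_mul, norm_pow]; simp
      _ ≤ 4 * B + 2 * (2 + w.im) * (2 * B) + (2 + w.im) ^ 2 * B := by gcongr
  -- `|Fbase| y ≤ ‖A₂‖ + 2 y ‖A₁‖ + |lam|`
  have hF : |Fbase w| * w.im ≤ ‖A₂ w‖ + 2 * w.im * ‖A₁ w‖ + |lam| := by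
    rw [Fbase]
    have e : ((A₂ w).im / w.im + 2 * (A₁ w).re + lam / w.im) * w.im = (A₂ w).im + 2 * w.im * (A₁ w).re + lam := by
      field_simp
    rw [← abs_of_pos hy0, ← abs_mul, abs_of_pos hy0, e]
    calc |(A₂ w).im + 2 * w.im * (A₁ w).re + lam| ≤ |(A₂ w).im| + |2 * w.im * (A₁ w).re| + |lam| :=
          abs_add_three _ _ _
      _ ≤ ‖A₂ w‖ + 2 * w.im * ‖A₁ w‖ + |lam| := by
          have h1 : |(A₂ w).im| ≤ ‖A₂ w‖ := Complex.abs_im_le_norm _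
          have h2 : |2 * w.im * (A₁ w).re| ≤ 2 * w.im * ‖A₁ w‖ := by
            rw [abs_mul, abs_of_pos (by linarith : (0:ℝ) < 2 * w.im)]
            exact mul_le_mul_of_nonneg_left (Complex.abs_re_le_norm _) (by linarith)
          linarith
  -- polynomial × exponential bound
  have hpoly : ‖A₂ w‖ + 2 * w.im * ‖A₁ w‖ ≤ 40 * K * ((2 + w.im) ^ 5 * E) := by
    have hy5 : (1:ℝ) ≤ 2 + w.im := hy2
    have hBle : B ≤ K * ((2 + w.im) ^ 5 * E) := by
      rw [hB]
      calc K * (2 + w.im) ^ 2 * E = K * ((2 + w.im) ^ 2 * E) := by ring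
        _ ≤ K * ((2 + w.im) ^ 5 * E) := by gcongr; norm_num
    have hB1le : (2 + w.im) * B ≤ K * ((2 + w.im) ^ 5 * E) := by
      rw [hB]
      calc (2 + w.im) * (K * (2 + w.im) ^ 2 * E) = K * ((2 + w.im) ^ 3 * E) := by ring
        _ ≤ K * ((2 + w.im) ^ 5 * E) := by gcongr; norm_num
    have hB2le : (2 + w.im) ^ 2 * B ≤ K * ((2 + w.im) ^ 5 * E) := by
      rw [hB]
      calc (2 + w.im) ^ 2 * (K * (2 + w.im) ^ 2 * E) = K * ((2 + w.im) ^ 4 * E) := by ring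
        _ ≤ K * ((2 + w.im) ^ 5 * E) := by gcongr; norm_num
    have ha1nn : 0 ≤ 2 * B + (2 + w.im) * B := by positivity
    have hyB : 2 * w.im * ‖A₁ w‖ ≤ 2 * (2 + w.im) * (2 * B + (2 + w.im) * B) := by
      calc 2 * w.im * ‖A₁ w‖ ≤ 2 * (2 + w.im) * ‖A₁ w‖ := by gcongr; linarith
        _ ≤ 2 * (2 + w.im) * (2 * B + (2 + w.im) * B) := by gcongr
    have e1 : 2 * (2 + w.im) * (2 * B + (2 + w.im) * B) = 4 * ((2 + w.im) * B) + 2 * ((2 + w.im) ^ 2 * B) := by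
      ring
    have e2 : 4 * B + 2 * (2 + w.im) * (2 * B) + (2 + w.im) ^ 2 * B =
        4 * B + 4 * ((2 + w.im) * B) + (2 + w.im) ^ 2 * B := by ring
    rw [e1] at hyB
    rw [e2] at hA2
    have hKE : 0 ≤ K * ((2 + w.im) ^ 5 * E) := by positivity
    linarith [hA2, hyB, hBle, hB1le, hB2le, hKE]
  have hexp : (2 + w.im) ^ 5 * E ≤ Real.exp (2 * π * a₀) * (120 * Real.exp 2) := by
    have h1 : E = Real.exp (2 * π * a₀) * Real.exp (-(2 * π) * w.im) := by
      rw [hE, ← Real.exp_add]; ring_nf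
    have h2 : Real.exp (-(2 * π) * w.im) ≤ Real.exp 2 * Real.exp (-(2 + w.im)) := by
      rw [← Real.exp_add]; apply Real.exp_le_exp.mpr; nlinarith [Real.pi_gt_three]
    have h3 := pow_five_mul_exp_neg_le (show (0:ℝ) ≤ 2 + w.im by linarith)
    have hp : 0 ≤ (2 + w.im) ^ 5 := by positivity
    calc (2 + w.im) ^ 5 * E = Real.exp (2 * π * a₀) * ((2 + w.im) ^ 5 * Real.exp (-(2 * π) * w.im)) := by
          rw [h1]; ring
      _ ≤ Real.exp (2 * π * a₀) * ((2 + w.im) ^ 5 * (Real.exp 2 * Real.exp (-(2 + w.im)))) := by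
          gcongr
      _ = Real.exp (2 * π * a₀) * (Real.exp 2 * ((2 + w.im) ^ 5 * Real.exp (-(2 + w.im)))) := by ring
      _ ≤ Real.exp (2 * π * a₀) * (Real.exp 2 * 120) := by gcongr
      _ = _ := by ring
  have hfin : 40 * K * ((2 + w.im) ^ 5 * E) ≤ 40 * K * (Real.exp (2 * π * a₀) * (120 * Real.exp 2)) := by
    gcongr
  linarith [hF, hpoly, hfin]

variable (hreal : (M₁ Complex.I).im = 0)
include hreal

/-- For `Im z ≥ 2` off the orbit, `Fρ z = Fbase(z − n)` with `|Re(z − n)| ≤ 1/2`. [folklore] -/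
theorem Fρ_eq_Fbase_translate {z : ℍ} (hz : z ∉ MulAction.orbit (Gamma0 1) cmRho) (hy : 2 ≤ z.im) :
    ∃ n : ℤ, |((z : ℂ) - n).re| ≤ 1 / 2 ∧ Fρ z = Fbase ((z : ℂ) - n) := by
  set n : ℤ := ⌊z.re + 1 / 2⌋ with hn
  have h1 : (n : ℝ) ≤ z.re + 1 / 2 := Int.floor_le _
  have h2 : z.re + 1 / 2 < n + 1 := Int.lt_floor_add_one _
  have hre : |((z : ℂ) - n).re| ≤ 1 / 2 := by
    rw [Complex.sub_re, Complex.intCast_re, UpperHalfPlane.coe_re, abs_le]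
    constructor <;> linarith
  refine ⟨n, hre, ?_⟩
  have hcoe : ((ModularGroup.T ^ (-n) • z : ℍ) : ℂ) = (z : ℂ) - n := by
    rw [UpperHalfPlane.modular_T_zpow_smul, UpperHalfPlane.coe_vadd]; push_cast; ring
  have hmem : ModularGroup.T ^ (-n) • z ∈ 𝒟 := by
    constructor
    · rw [hcoe, Complex.normSq_apply]
      have : ((z:ℂ) - n).im = z.im := by simp
      nlinarith [sq_nonneg (((z:ℂ) - n).re), Complex.sub_im (z:ℂ) n, this]
    · rw [← UpperHalfPlane.coe_re, hcoe]; exact hre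
  rw [Fρ_eq_of_smul_mem_fd hreal hz hmem, hcoe]

/-- **`Fρ` has properties (a), (c) and `SL₂(ℤ)`-invariance: `IsResolventGreenLike 1 2 cmRho Fρ`.** [cite: GrossZagier1986, §II.2] -/
theorem isResolventGreenLike_Fρ : IsResolventGreenLike 1 2 cmRho Fρ where
  smul_eq γ _ z := Fρ_smul hreal γ z
  contDiffAt z hz := (contDiffAt_laplacian_Fρ hreal hz).1
  laplacian_eq z hz := by
    have := (contDiffAt_laplacian_Fρ hreal hz).2
    simpa using this
  cusp_bound σ := by
    obtain ⟨C, hC⟩ := exists_Fbase_cusp_bound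
    refine ⟨max C 0, 2, fun z hz => ?_⟩
    rw [Fρ_smul hreal]
    simp only [show (2 - 1 : ℕ) = 1 from rfl, pow_one]
    by_cases hzo : z ∈ MulAction.orbit (Gamma0 1) cmRho
    · rw [Fρ, if_pos hzo]; simp
    · obtain ⟨n, hre, hF⟩ := Fρ_eq_Fbase_translate hreal hzo hz
      rw [hF]
      have him : ((z : ℂ) - n).im = z.im := by simp
      have := hC ((z : ℂ) - n) hre (by rw [him]; exact hz)
      rw [him] at this
      exact this.trans (le_max_left _ _)

end CuspBound

/-! ## 8. The logarithmic singularity at `ρ' = cmRho` -/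

section Singularity

open ModularGroup CongruenceSubgroup
open scoped Modular

/-- `ρ'` as a complex number. [folklore] -/
def ρ' : ℂ := (cmRho : ℂ)

/-- Auxiliary step `ρ'_im` of the Eichler-integral construction. [folklore] -/
theorem ρ'_im : ρ'.im = a₀ := by simp [ρ', cmRho, a₀]

/-- Auxiliary step `ρ'_re` of the Eichler-integral construction. [folklore] -/
theorem ρ'_re : ρ'.re = 1 / 2 := by simp [ρ', cmRho]

/-- Auxiliary step `ofComplex_ρ'` of the Eichler-integral construction. [folklore] -/
theorem ofComplex_ρ' : ofComplex ρ' = cmRho := by rw [ρ']; exact ofComplex_apply cmRho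

/-- `E₄(ρ') = 0`. [folklore] -/
theorem E₄_cmRho : E₄ cmRho = 0 := E₄_eq_zero_iff.mpr ⟨ModularGroup.T, cmRho_eq_T_smul.symm⟩

/-- `E₆(ρ') ≠ 0`. [folklore] -/
theorem E₆_cmRho_ne_zero : E₆ cmRho ≠ 0 := by
  intro h
  have := ModularForm.discriminant_ne_zero cmRho
  rw [ModularForm.discriminant_eq_E₄_cube_sub_E₆_sq, E₄_cmRho, h] at this
  norm_num at this

/-- `Δ(ρ') = −E₆(ρ')²/1728`. [folklore] -/
theorem discriminant_cmRho : ModularForm.discriminant cmRho = -(E₆ cmRho) ^ 2 / 1728 := by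
  rw [ModularForm.discriminant_eq_E₄_cube_sub_E₆_sq, E₄_cmRho]; ring

/-- `(E₄ ∘ ofComplex)'(ρ') = −(2πi/3) E₆(ρ')`. [folklore] -/
theorem deriv_E₄_cmRho : deriv ((E₄ : ℍ → ℂ) ∘ ofComplex) ρ' = -(2 * π * Complex.I / 3) * E₆ cmRho := by
  rw [ρ', deriv_comp_ofComplex_eq, normalizedDeriv_E₄, E₄_cmRho]; ring

/-- The residue datum `a := Δ(ρ')/E₄'(ρ')² = 1/(768π²)`. [folklore] -/
def aρ : ℝ := 1 / (768 * π ^ 2)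

/-- Auxiliary step `aρ_pos` of the Eichler-integral construction. [folklore] -/
theorem aρ_pos : 0 < aρ := by rw [aρ]; positivity

/-- Auxiliary step `aρ_eq` of the Eichler-integral construction. [folklore] -/
theorem aρ_eq : (aρ : ℂ) = ModularForm.discriminant cmRho / (deriv ((E₄ : ℍ → ℂ) ∘ ofComplex) ρ') ^ 2 := by
  rw [deriv_E₄_cmRho, discriminant_cmRho, aρ]
  have h6 := E₆_cmRho_ne_zero
  have hπ : (π : ℂ) ≠ 0 := by exact_mod_cast Real.pi_ne_zero
  push_cast
  field_simp
  ring_nf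
  rw [Complex.I_sq]; ring

/-- Analyticity of `dslope` at the base point. [folklore] -/
theorem analyticAt_dslope {F : ℂ → ℂ} {z₀ : ℂ} (h : AnalyticAt ℂ F z₀) : AnalyticAt ℂ (dslope F z₀) z₀ := by
  obtain ⟨p, hp⟩ := h
  exact ⟨_, hp.has_fpower_series_dslope_fslope⟩

/-- **Local structure of `f = Δ/E₄²` at `ρ'`**: there are `b ∈ ℂ` and `h` continuous at `ρ'` with
`f(ζ) = a/(ζ−ρ')² + b/(ζ−ρ') + h(ζ)` for `ζ ≠ ρ'` near `ρ'` in `ℍ`. [folklore] -/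
theorem fC_local_expansion : ∃ b : ℂ, ∃ h : ℂ → ℂ, ContinuousAt h ρ' ∧
    ∀ᶠ ζ in 𝓝 ρ', ζ ≠ ρ' → 0 < ζ.im →
      fC ζ = aρ / (ζ - ρ') ^ 2 + b / (ζ - ρ') + h ζ := by
  set F : ℂ → ℂ := (E₄ : ℍ → ℂ) ∘ ofComplex with hF
  set g : ℂ → ℂ := dslope F ρ' with hg
  have hFan : AnalyticAt ℂ F ρ' := by rw [hF, ρ']; exact analyticAt_comp_ofComplex (ModularFormClass.holo E₄) cmRho
  have hgan : AnalyticAt ℂ g ρ' := analyticAt_dslope hFan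
  have hF0 : F ρ' = 0 := by simp [hF, ofComplex_ρ', E₄_cmRho]
  have hg0 : g ρ' = deriv F ρ' := dslope_same F ρ'
  have hd : deriv F ρ' ≠ 0 := by
    rw [hF, deriv_E₄_cmRho]
    have hπ : (π : ℂ) ≠ 0 := by exact_mod_cast Real.pi_ne_zero
    exact mul_ne_zero (by simp [hπ, Complex.I_ne_zero]) E₆_cmRho_ne_zero
  have hgne : g ρ' ≠ 0 := by rwa [hg0]
  -- `E₄ = (ζ − ρ') g`
  have hE4 : ∀ ζ, F ζ = (ζ - ρ') * g ζ := fun ζ => by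
    have := sub_smul_dslope F ρ' ζ
    rw [smul_eq_mul, hF0, sub_zero] at this
    exact this.symm
  set Dl : ℂ → ℂ := (ModularForm.discriminant : ℍ → ℂ) ∘ ofComplex with hDl
  have hDan : AnalyticAt ℂ Dl ρ' := by rw [hDl, ρ']; exact analyticAt_comp_ofComplex (CuspFormClass.holo CuspForm.discriminant) cmRho
  set φ : ℂ → ℂ := fun ζ => Dl ζ / g ζ ^ 2 with hφ
  have hφan : AnalyticAt ℂ φ ρ' := hDan.div (hgan.pow 2) (pow_ne_zero 2 hgne)
  have hφ0 : φ ρ' = aρ := by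
    rw [hφ, aρ_eq]; simp only
    rw [hg0, hDl, Function.comp_apply, ofComplex_ρ']
  set ψ₁ : ℂ → ℂ := dslope φ ρ' with hψ₁
  have hψ₁an : AnalyticAt ℂ ψ₁ ρ' := analyticAt_dslope hφan
  set ψ₂ : ℂ → ℂ := dslope ψ₁ ρ' with hψ₂
  have hψ₂an : AnalyticAt ℂ ψ₂ ρ' := analyticAt_dslope hψ₁an
  refine ⟨ψ₁ ρ', ψ₂, hψ₂an.continuousAt, ?_⟩
  -- `g ≠ 0` near `ρ'`
  have hgnz : ∀ᶠ ζ in 𝓝 ρ', g ζ ≠ 0 := hgan.continuousAt.eventually_ne hgne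
  filter_upwards [hgnz] with ζ hgζ hne hpos
  have h1 : φ ζ = aρ + (ζ - ρ') * ψ₁ ζ := by
    have := sub_smul_dslope φ ρ' ζ
    rw [smul_eq_mul, hφ0] at this
    linear_combination -this
  have h2 : ψ₁ ζ = ψ₁ ρ' + (ζ - ρ') * ψ₂ ζ := by
    have := sub_smul_dslope ψ₁ ρ' ζ
    rw [smul_eq_mul] at this
    linear_combination -this
  have hsub : ζ - ρ' ≠ 0 := sub_ne_zero.mpr hne
  have hfC : fC ζ = φ ζ / (ζ - ρ') ^ 2 := by
    rw [fC, fΔE4]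
    have e4 : E₄ (ofComplex ζ) = F ζ := rfl
    have eD : ModularForm.discriminant (ofComplex ζ) = Dl ζ := rfl
    rw [e4, eD, hE4 ζ, hφ]
    field_simp
  rw [hfC, h1, h2]
  field_simp
  ring

/-- `‖log v‖ ≤ |log ‖v‖| + π`. [folklore] -/
theorem norm_log_le (v : ℂ) : ‖Complex.log v‖ ≤ |Real.log ‖v‖| + π := by
  refine (Complex.norm_le_abs_re_add_abs_im _).trans ?_
  rw [Complex.log_re, Complex.log_im]
  gcongr
  exact Complex.abs_arg_le_pi v

/-- `‖v log v‖ ≤ 1 + π` for `‖v‖ ≤ 1`. [folklore] -/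
theorem norm_mul_log_le {v : ℂ} (hv : ‖v‖ ≤ 1) : ‖v * Complex.log v‖ ≤ 1 + π := by
  by_cases h0 : v = 0
  · subst h0; simp; positivity
  have hpos : 0 < ‖v‖ := norm_pos_iff.mpr h0
  rw [norm_mul]
  calc ‖v‖ * ‖Complex.log v‖ ≤ ‖v‖ * (|Real.log ‖v‖| + π) := by gcongr; exact norm_log_le v
    _ = |Real.log ‖v‖ * ‖v‖| + ‖v‖ * π := by rw [abs_mul, abs_of_pos hpos]; ring
    _ ≤ 1 + 1 * π := by
        gcongr
        · exact (Real.abs_log_mul_self_lt ‖v‖ hpos hv).le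
    _ = 1 + π := by ring

/-- Bounded derivative on a bounded convex set gives a bounded function. [folklore] -/
theorem bounded_of_deriv_bounded {R R' : ℂ → ℂ} {V : Set ℂ} (hV : Convex ℝ V) {u₁ : ℂ} (hu₁ : u₁ ∈ V)
    {K d : ℝ} (hd : ∀ u ∈ V, ‖u - u₁‖ ≤ d) (hR : ∀ u ∈ V, HasDerivAt R (R' u) u) (hK : ∀ u ∈ V, ‖R' u‖ ≤ K) :
    ∀ u ∈ V, ‖R u‖ ≤ ‖R u₁‖ + K * d := by
  intro u hu
  have hK0 : 0 ≤ K := (norm_nonneg _).trans (hK u₁ hu₁)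
  have h := hV.norm_image_sub_le_of_norm_hasDerivWithin_le (fun x hx => (hR x hx).hasDerivWithinAt) hK hu₁ hu
  calc ‖R u‖ = ‖R u₁ + (R u - R u₁)‖ := by ring_nf
    _ ≤ ‖R u₁‖ + ‖R u - R u₁‖ := norm_add_le _ _
    _ ≤ ‖R u₁‖ + K * ‖u - u₁‖ := by linarith
    _ ≤ ‖R u₁‖ + K * d := by gcongr; exact hd u hu

/-- **Logarithmic asymptotics**: near `ρ'` in `Im > a₀`,
`A₁(u) = −a log(u − ρ') + O(1)` and `A₂(u) = O(1)`. [folklore] -/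
theorem A₁_A₂_near_ρ' : ∃ K ε : ℝ, 0 < ε ∧ ∀ u : ℂ, ‖u - ρ'‖ < ε → a₀ < u.im →
    ‖A₁ u + aρ * Complex.log (u - ρ')‖ ≤ K ∧ ‖A₂ u‖ ≤ K := by
  obtain ⟨b, h, hcont, hexp⟩ := fC_local_expansion
  -- choose `ε` with the expansion valid and `h` bounded on the ball
  have hbd : ∀ᶠ ζ in 𝓝 ρ', ‖h ζ‖ < ‖h ρ'‖ + 1 := by
    have := hcont.norm
    exact this.eventually (gt_mem_nhds (by linarith))
  obtain ⟨ε₀, hε₀, hball⟩ := Metric.eventually_nhds_iff_ball.mp (hexp.and hbd)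
  set ε : ℝ := min (ε₀ / 2) (1 / 2) with hεdef
  have hε : 0 < ε := by rw [hεdef]; positivity
  have hεle : ε ≤ ε₀ / 2 := min_le_left _ _
  have hε1 : ε ≤ 1 / 2 := min_le_right _ _
  set V : Set ℂ := {u : ℂ | ‖u - ρ'‖ < ε ∧ a₀ < u.im} with hV
  have hVconv : Convex ℝ V := by
    have : V = Metric.ball ρ' ε ∩ {u : ℂ | a₀ < u.im} := by
      ext u; simp [hV, dist_eq_norm]
    rw [this]
    exact (convex_ball _ _).inter (convex_halfSpace_gt Complex.imLm.isLinear a₀)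
  have hVball : ∀ u ∈ V, u ∈ Metric.ball ρ' ε₀ := fun u hu => by
    rw [Metric.mem_ball, dist_eq_norm]; linarith [hu.1]
  have hVne : ∀ u ∈ V, u ≠ ρ' := fun u hu h0 => by
    have := hu.2; rw [h0, ρ'_im] at this; exact lt_irrefl _ this
  have hVpos : ∀ u ∈ V, 0 < u.im := fun u hu => a₀_pos.trans hu.2
  have hVslit : ∀ u ∈ V, u - ρ' ∈ Complex.slitPlane := fun u hu => by
    rw [Complex.mem_slitPlane_iff]; right
    have : (u - ρ').im = u.im - a₀ := by simp [ρ'_im]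
    rw [this]; linarith [hu.2]
  -- base point
  set u₁ : ℂ := ρ' + (ε / 2 : ℝ) * Complex.I with hu₁def
  have hu₁ : u₁ ∈ V := by
    refine ⟨?_, ?_⟩
    · rw [hu₁def, add_sub_cancel_left, norm_mul, Complex.norm_real, Complex.norm_I, mul_one,
        Real.norm_eq_abs, abs_of_pos (by positivity)]
      linarith
    · rw [hu₁def]; simp [ρ'_im]; positivity
  have hdist : ∀ u ∈ V, ‖u - u₁‖ ≤ 2 * ε := fun u hu => by
    calc ‖u - u₁‖ = ‖(u - ρ') - (u₁ - ρ')‖ := by ring_nf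
      _ ≤ ‖u - ρ'‖ + ‖u₁ - ρ'‖ := norm_sub_le _ _
      _ ≤ ε + ε := by gcongr <;> [exact hu.1.le; exact hu₁.1.le]
      _ = 2 * ε := by ring
  -- the expansion on `V`
  have hfexp : ∀ u ∈ V, fC u = aρ / (u - ρ') ^ 2 + b / (u - ρ') + h u := fun u hu =>
    (hball u (hVball u hu)).1 (hVne u hu) (hVpos u hu)
  have hhb : ∀ u ∈ V, ‖h u‖ ≤ ‖h ρ'‖ + 1 := fun u hu => ((hball u (hVball u hu)).2).le
  -- Step 0: `R₀ := M₀ − a/(u−ρ') + b log(u−ρ')` has derivative `−h`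
  set R₀ : ℂ → ℂ := fun u => M₀ u - aρ / (u - ρ') + b * Complex.log (u - ρ') with hR₀
  have hR₀d : ∀ u ∈ V, HasDerivAt R₀ (-h u) u := by
    intro u hu
    have hsub : u - ρ' ≠ 0 := sub_ne_zero.mpr (hVne u hu)
    have h1 := hasDerivAt_M₀ hu.2
    have h2 : HasDerivAt (fun u => (aρ : ℂ) / (u - ρ')) (-(aρ : ℂ) / (u - ρ') ^ 2) u := by
      have := ((hasDerivAt_id u).sub_const ρ').inv hsub
      have := this.const_mul (aρ : ℂ)
      refine (this.congr_of_eventuallyEq (Eventually.of_forall fun v => by simp [div_eq_mul_inv])).congr_deriv ?_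
      simp; ring
    have h3 : HasDerivAt (fun u => b * Complex.log (u - ρ')) (b * (u - ρ')⁻¹) u := by
      have := ((Complex.hasDerivAt_log (hVslit u hu)).comp u ((hasDerivAt_id u).sub_const ρ'))
      simpa using this.const_mul b
    have := (h1.sub h2).add h3
    refine (this.congr_of_eventuallyEq (Eventually.of_forall fun v => rfl)).congr_deriv ?_
    rw [hfexp u hu]
    field_simp
    ring
  have hR₀b := bounded_of_deriv_bounded (K := ‖h ρ'‖ + 1) hVconv hu₁ hdist hR₀d
    (fun u hu => by rw [norm_neg]; exact hhb u hu)
  set K₀ : ℝ := ‖R₀ u₁‖ + (‖h ρ'‖ + 1) * (2 * ε) with hK₀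
  -- Step 1: `R₁ := A₁ + a log(u−ρ') − b Λ(u)` has derivative `−R₀`
  set Λ : ℂ → ℂ := fun u => (u - ρ') * Complex.log (u - ρ') - (u - ρ') with hΛ
  have hΛd : ∀ u ∈ V, HasDerivAt Λ (Complex.log (u - ρ')) u := by
    intro u hu
    have hsub : u - ρ' ≠ 0 := sub_ne_zero.mpr (hVne u hu)
    have hl := (Complex.hasDerivAt_log (hVslit u hu)).comp u ((hasDerivAt_id u).sub_const ρ')
    have h1 := ((hasDerivAt_id u).sub_const ρ').mul hl
    have := h1.sub ((hasDerivAt_id u).sub_const ρ')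
    refine (this.congr_of_eventuallyEq (Eventually.of_forall fun v => rfl)).congr_deriv ?_
    simp only [Function.comp_apply, id]
    field_simp
    ring
  have hΛb : ∀ u ∈ V, ‖Λ u‖ ≤ 2 + π := by
    intro u hu
    have hv0 : ‖u - ρ'‖ < ε := hu.1
    have hv1 : ‖u - ρ'‖ ≤ 1 := by linarith
    calc ‖Λ u‖ ≤ ‖(u - ρ') * Complex.log (u - ρ')‖ + ‖u - ρ'‖ := norm_sub_le _ _
      _ ≤ (1 + π) + 1 := by gcongr; exact norm_mul_log_le hv1
      _ = 2 + π := by ring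
  set R₁ : ℂ → ℂ := fun u => A₁ u + aρ * Complex.log (u - ρ') - b * Λ u with hR₁
  have hR₁d : ∀ u ∈ V, HasDerivAt R₁ (-R₀ u) u := by
    intro u hu
    have hsub : u - ρ' ≠ 0 := sub_ne_zero.mpr (hVne u hu)
    have h1 := hasDerivAt_A₁ hu.2
    have h2 : HasDerivAt (fun u => (aρ : ℂ) * Complex.log (u - ρ')) ((aρ : ℂ) * (u - ρ')⁻¹) u := by
      have := ((Complex.hasDerivAt_log (hVslit u hu)).comp u ((hasDerivAt_id u).sub_const ρ'))
      simpa using this.const_mul (aρ : ℂ)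
    have h3 := (hΛd u hu).const_mul b
    have := (h1.add h2).sub h3
    refine (this.congr_of_eventuallyEq (Eventually.of_forall fun v => rfl)).congr_deriv ?_
    simp only [hR₀]
    field_simp
    ring
  have hR₁b := bounded_of_deriv_bounded (K := ‖R₀ u₁‖ + (‖h ρ'‖ + 1) * (2 * ε)) hVconv hu₁ hdist hR₁d
    (fun u hu => by rw [norm_neg]; exact hR₀b u hu)
  set K₁ : ℝ := ‖R₁ u₁‖ + K₀ * (2 * ε) with hK₁
  have hA1b : ∀ u ∈ V, ‖A₁ u + aρ * Complex.log (u - ρ')‖ ≤ K₁ + ‖b‖ * (2 + π) := by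
    intro u hu
    have e : A₁ u + aρ * Complex.log (u - ρ') = R₁ u + b * Λ u := by simp only [hR₁]; ring
    rw [e]
    calc ‖R₁ u + b * Λ u‖ ≤ ‖R₁ u‖ + ‖b‖ * ‖Λ u‖ := by
          refine (norm_add_le _ _).trans ?_; rw [norm_mul]
      _ ≤ K₁ + ‖b‖ * (2 + π) := by gcongr <;> [exact hR₁b u hu; exact hΛb u hu]
  -- Step 2: `R₂ := A₂ − 2aΛ` has derivative `−2(A₁ + a log)`
  set R₂ : ℂ → ℂ := fun u => A₂ u - 2 * aρ * Λ u with hR₂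
  have hR₂d : ∀ u ∈ V, HasDerivAt R₂ (-(2 * (A₁ u + aρ * Complex.log (u - ρ')))) u := by
    intro u hu
    have h1 := hasDerivAt_A₂ hu.2
    have h2 := (hΛd u hu).const_mul (2 * (aρ : ℂ))
    have := h1.sub h2
    refine (this.congr_of_eventuallyEq (Eventually.of_forall fun v => rfl)).congr_deriv ?_
    ring
  have hR₂b := bounded_of_deriv_bounded (K := 2 * (K₁ + ‖b‖ * (2 + π))) hVconv hu₁ hdist hR₂d
    (fun u hu => by rw [norm_neg, norm_mul, Complex.norm_two]; linarith [hA1b u hu])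
  refine ⟨max (K₁ + ‖b‖ * (2 + π)) (‖R₂ u₁‖ + 2 * (K₁ + ‖b‖ * (2 + π)) * (2 * ε) + 2 * aρ * (2 + π)),
    ε, hε, fun u hu1 hu2 => ?_⟩
  have hu : u ∈ V := ⟨hu1, hu2⟩
  refine ⟨(hA1b u hu).trans (le_max_left _ _), le_trans ?_ (le_max_right _ _)⟩
  have e : A₂ u = R₂ u + 2 * aρ * Λ u := by simp only [hR₂]; ring
  rw [e]
  calc ‖R₂ u + 2 * aρ * Λ u‖ ≤ ‖R₂ u‖ + 2 * aρ * ‖Λ u‖ := by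
        refine (norm_add_le _ _).trans ?_
        rw [norm_mul, norm_mul, Complex.norm_two, Complex.norm_real, Real.norm_eq_abs, abs_of_pos aρ_pos]
    _ ≤ ‖R₂ u₁‖ + 2 * (K₁ + ‖b‖ * (2 + π)) * (2 * ε) + 2 * aρ * (2 + π) := by
        have ha2 : 0 ≤ 2 * aρ := by linarith [aρ_pos]
        gcongr
        · exact hR₂b u hu
        · exact hΛb u hu

end Singularity

section NearCorner

open ModularGroup CongruenceSubgroup
open scoped Modular

/-- `Fbase` near `ρ'`: `Fbase(u) = −2a log‖u − ρ'‖ + O(1)` on `Im u > a₀`. [folklore] -/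
theorem Fbase_log_bound : ∃ K ε : ℝ, 0 < ε ∧ ∀ u : ℂ, ‖u - ρ'‖ < ε → a₀ < u.im →
    |Fbase u + 2 * aρ * Real.log ‖u - ρ'‖| ≤ K := by
  obtain ⟨K, ε, hε, hK⟩ := A₁_A₂_near_ρ'
  refine ⟨K / a₀ + 2 * K + |lam| / a₀, ε, hε, fun u hu1 hu2 => ?_⟩
  obtain ⟨h1, h2⟩ := hK u hu1 hu2
  have hy : 0 < u.im := a₀_pos.trans hu2
  rw [Fbase]
  -- real part of `A₁ + a log`
  have hre : |(A₁ u).re + aρ * Real.log ‖u - ρ'‖| ≤ K := by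
    have e : (A₁ u).re + aρ * Real.log ‖u - ρ'‖ = (A₁ u + aρ * Complex.log (u - ρ')).re := by
      simp [Complex.log_re]
    rw [e]; exact (Complex.abs_re_le_norm _).trans h1
  have him : |(A₂ u).im| ≤ K := (Complex.abs_im_le_norm _).trans h2
  have hK0 : 0 ≤ K := (norm_nonneg _).trans h2
  have hdiv1 : |(A₂ u).im / u.im| ≤ K / a₀ := by
    rw [abs_div, abs_of_pos hy]
    calc |(A₂ u).im| / u.im ≤ K / u.im := by gcongr
      _ ≤ K / a₀ := div_le_div_of_nonneg_left hK0 a₀_pos hu2.le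
  have hdiv2 : |lam / u.im| ≤ |lam| / a₀ := by
    rw [abs_div, abs_of_pos hy]
    exact div_le_div_of_nonneg_left (abs_nonneg _) a₀_pos hu2.le
  have e : (A₂ u).im / u.im + 2 * (A₁ u).re + lam / u.im + 2 * aρ * Real.log ‖u - ρ'‖ =
      (A₂ u).im / u.im + 2 * ((A₁ u).re + aρ * Real.log ‖u - ρ'‖) + lam / u.im := by ring
  rw [e]
  calc |(A₂ u).im / u.im + 2 * ((A₁ u).re + aρ * Real.log ‖u - ρ'‖) + lam / u.im|
      ≤ |(A₂ u).im / u.im| + |2 * ((A₁ u).re + aρ * Real.log ‖u - ρ'‖)| + |lam / u.im| := abs_add_three _ _ _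
    _ ≤ K / a₀ + 2 * K + |lam| / a₀ := by
        rw [abs_mul, abs_two]
        gcongr

/-- `Fbase` is invariant under integer translations. [folklore] -/
theorem Fbase_add_int {w : ℂ} (hw : a₀ < w.im) (n : ℤ) : Fbase (w + n) = Fbase w := by
  induction n using Int.induction_on with
  | zero => simp
  | succ n ih =>
      have h : a₀ < (w + (n : ℂ)).im := by simpa using hw
      have := Fbase_add_one h
      push_cast at this ih ⊢
      rw [← add_assoc, this, ih]
  | pred n ih =>
      have h : a₀ < (w + ((-(n : ℤ) - 1 : ℤ) : ℂ)).im := by simpa using hw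
      have := Fbase_add_one h
      rw [← this]
      push_cast at ih ⊢
      rw [show w + (-(n : ℂ) - 1) + 1 = w + -(n : ℂ) by ring, ih]

/-- Coordinates of the `SL₂(ℤ)`-action. [folklore] -/
theorem coe_smul_int (g : SL(2, ℤ)) (z : ℍ) :
    ((g • z : ℍ) : ℂ) = (((g 0 0 : ℤ) : ℂ) * z + ((g 0 1 : ℤ) : ℂ)) / (((g 1 0 : ℤ) : ℂ) * z + ((g 1 1 : ℤ) : ℂ)) := by
  rw [UpperHalfPlane.coe_specialLinearGroup_apply]; simp

/-- Auxiliary step `im_smul_int` of the Eichler-integral construction. [folklore] -/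
theorem im_smul_int (g : SL(2, ℤ)) (z : ℍ) :
    (g • z).im = z.im / Complex.normSq (((g 1 0 : ℤ) : ℂ) * z + ((g 1 1 : ℤ) : ℂ)) := by
  have h := ModularGroup.im_smul_eq_div_normSq g z
  rw [ModularGroup.denom_apply] at h
  simpa using h

/-- Auxiliary step `det_int` of the Eichler-integral construction. [folklore] -/
theorem det_int (g : SL(2, ℤ)) : g 0 0 * g 1 1 - g 0 1 * g 1 0 = 1 := by
  have := Matrix.SpecialLinearGroup.det_coe g
  rw [Matrix.det_fin_two] at this
  linarith

/-- The admissible bottom rows near the corner. [folklore] -/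
theorem bottom_row_cases {c d : ℤ} (hc : c ^ 2 < 2) (hm : c ^ 2 + c * d + d ^ 2 < 3) (h0 : ¬(c = 0 ∧ d = 0)) :
    (c = 0 ∧ (d = 1 ∨ d = -1)) ∨ (c = 1 ∧ (d = 0 ∨ d = -1)) ∨ (c = -1 ∧ (d = 0 ∨ d = 1)) := by
  have hc1 : c ≤ 1 := by nlinarith
  have hc2 : -1 ≤ c := by nlinarith
  have hd1 : d ≤ 1 := by nlinarith
  have hd2 : -2 ≤ d := by nlinarith
  interval_cases c <;> interval_cases d <;> simp_all

/-- Auxiliary step `normSq_ρ'` of the Eichler-integral construction. [folklore] -/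
theorem normSq_ρ' : Complex.normSq ρ' = 1 := by
  rw [Complex.normSq_apply, ρ'_re, ρ'_im, a₀]
  have : Real.sqrt 3 * Real.sqrt 3 = 3 := Real.mul_self_sqrt (by norm_num)
  nlinarith

/-- Auxiliary step `norm_ρ'` of the Eichler-integral construction. [folklore] -/
theorem norm_ρ' : ‖ρ'‖ = 1 := by
  have h := normSq_ρ'
  rw [Complex.normSq_eq_norm_sq] at h
  nlinarith [norm_nonneg ρ']

/-- Auxiliary step `norm_ρ'_sub_one` of the Eichler-integral construction. [folklore] -/
theorem norm_ρ'_sub_one : ‖ρ' - 1‖ = 1 := by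
  have h : Complex.normSq (ρ' - 1) = 1 := by
    rw [Complex.normSq_apply]; simp [ρ'_re, ρ'_im, a₀]
    have : Real.sqrt 3 * Real.sqrt 3 = 3 := Real.mul_self_sqrt (by norm_num)
    nlinarith
  have h2 : ‖ρ' - 1‖ ^ 2 = 1 := by rw [← Complex.normSq_eq_norm_sq]; exact h
  nlinarith [norm_nonneg (ρ' - 1)]

/-- `ρ'² = ρ' − 1`, i.e. `Sc ρ' = ρ' − 1` and `Sc (ρ' − 1) = ρ'`. [folklore] -/
theorem ρ'_sq : ρ' * ρ' = ρ' - 1 := by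
  apply Complex.ext
  · simp [Complex.mul_re, ρ'_re, ρ'_im, a₀]
    have : Real.sqrt 3 * Real.sqrt 3 = 3 := Real.mul_self_sqrt (by norm_num)
    nlinarith
  · simp [Complex.mul_im, ρ'_re, ρ'_im]; ring

/-- Auxiliary step `ρ'_ne_zero` of the Eichler-integral construction. [folklore] -/
theorem ρ'_ne_zero : ρ' ≠ 0 := fun h => by simpa [h] using norm_ρ'

/-- Auxiliary step `Sc_ρ'` of the Eichler-integral construction. [folklore] -/
theorem Sc_ρ' : Sc ρ' = ρ' - 1 := by
  rw [Sc]
  apply mul_left_cancel₀ ρ'_ne_zero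
  rw [mul_neg, mul_inv_cancel₀ ρ'_ne_zero, mul_sub, ρ'_sq]; ring

/-- Auxiliary step `Sc_ρ'_sub_one` of the Eichler-integral construction. [folklore] -/
theorem Sc_ρ'_sub_one : Sc (ρ' - 1) = ρ' := by
  have h1 : ρ' - 1 ≠ 0 := fun h => by simpa [h] using norm_ρ'_sub_one
  rw [Sc]
  apply mul_left_cancel₀ h1
  rw [mul_neg, mul_inv_cancel₀ h1, sub_mul, ρ'_sq]; ring

set_option maxHeartbeats 1600000 in
/-- **The representative near the corner.** For `z` off the orbit and close to `ρ'`, `Fρ z = Fbase v`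
for some `v ∈ {z, −1/z + 1, −1/(z−1)}` with `Im v > a₀` and `‖v − ρ'‖ ≍ ‖z − ρ'‖`. [folklore] -/
theorem rep_near_ρ' : ∀ z : ℍ, z ∉ MulAction.orbit (Gamma0 1) cmRho → ‖(z : ℂ) - ρ'‖ < a₀ / 10 →
    ∃ v : ℂ, a₀ < v.im ∧ Fρ z = Fbase v ∧ ‖v - ρ'‖ ≤ 2 * ‖(z : ℂ) - ρ'‖ ∧
      ‖(z : ℂ) - ρ'‖ ≤ 2 * ‖v - ρ'‖ := by
  intro z hz hδ
  have ha := a₀_pos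
  have ha2 : a₀ ^ 2 = 3 / 4 := by rw [a₀, div_pow, Real.sq_sqrt (by norm_num)]; norm_num
  have hδ1 : a₀ / 10 < 1 / 10 := by linarith [a₀_lt_one]
  set g := repElt z with hg
  set u : ℍ := g • z with hu
  have hufd : u ∈ 𝒟 := repElt_smul_mem z
  have huno : u ∉ MulAction.orbit (Gamma0 1) cmRho := (smul_mem_orbit_iff' g z).not.mpr hz
  have hFρ : Fρ z = Fbase (u : ℂ) := Fρ_of_notMem hz
  have hua : a₀ < u.im := a₀_lt_im_of_mem_fd_of_notMem hufd huno
  have hure : |u.re| ≤ 1 / 2 := hufd.2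
  set a : ℤ := g 0 0
  set b : ℤ := g 0 1
  set c : ℤ := g 1 0
  set d : ℤ := g 1 1
  have hdet : a * d - b * c = 1 := det_int g
  have hcoe : ((u : ℍ) : ℂ) = ((a : ℂ) * z + (b : ℂ)) / ((c : ℂ) * z + (d : ℂ)) := coe_smul_int g z
  have him : u.im = z.im / Complex.normSq ((c : ℂ) * z + (d : ℂ)) := im_smul_int g z
  -- `Im z` is close to `a₀`
  have hzim : |z.im - a₀| < a₀ / 10 := by
    have : ((z : ℂ) - ρ').im = z.im - a₀ := by simp [ρ'_im]
    rw [← this]; exact (Complex.abs_im_le_norm _).trans_lt hδ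
  have hzim1 : a₀ - a₀ / 10 < z.im := by linarith [(abs_lt.mp hzim).1]
  have hzim2 : z.im < a₀ + a₀ / 10 := by linarith [(abs_lt.mp hzim).2]
  -- `N = normSq (cz+d) = Im z / Im u < 1.1`
  set N := Complex.normSq ((c : ℂ) * z + (d : ℂ)) with hN
  have hcd0 : ¬(c = 0 ∧ d = 0) := by rintro ⟨h1, h2⟩; rw [h1, h2] at hdet; simp at hdet
  have hN0 : 0 < N := by
    have hu0 := u.im_pos
    rw [him] at hu0
    rcases div_pos_iff.mp hu0 with h | h
    · exact h.2
    · exact absurd z.im_pos (not_lt.mpr h.1.le)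
  have hNeq : N = z.im / u.im := by
    rw [him]; field_simp
  have hN1 : N < 11 / 10 := by
    rw [hNeq, div_lt_iff₀ (ha.trans hua)]; nlinarith
  -- `|c| ≤ 1`
  have hre1 : ((c : ℂ) * z + (d : ℂ)).re = (c : ℝ) * z.re + d := by
    simp only [Complex.add_re, Complex.mul_re, Complex.intCast_re, Complex.intCast_im, zero_mul,
      sub_zero, UpperHalfPlane.coe_re]
  have him1 : ((c : ℂ) * z + (d : ℂ)).im = (c : ℝ) * z.im := by
    simp only [Complex.add_im, Complex.mul_im, Complex.intCast_re, Complex.intCast_im, zero_mul,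
      add_zero, UpperHalfPlane.coe_im]
  have hNexp : N = ((c : ℝ) * z.re + d) ^ 2 + (c : ℝ) ^ 2 * z.im ^ 2 := by
    rw [hN, Complex.normSq_apply, hre1, him1]; ring
  have hc2 : c ^ 2 < 2 := by
    have h1 : (c : ℝ) ^ 2 * z.im ^ 2 ≤ N := by rw [hNexp]; nlinarith
    have h2 : (c : ℝ) ^ 2 * (a₀ - a₀ / 10) ^ 2 < 11 / 10 := by
      calc (c : ℝ) ^ 2 * (a₀ - a₀ / 10) ^ 2 ≤ (c : ℝ) ^ 2 * z.im ^ 2 := by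
            gcongr; linarith
        _ < 11 / 10 := by linarith
    have h3 : (c : ℝ) ^ 2 < 2 := by nlinarith
    exact_mod_cast h3
  -- `m = c² + cd + d² < 3`
  have hm : c ^ 2 + c * d + d ^ 2 < 3 := by
    have hre2 : ((c : ℂ) * ρ' + (d : ℂ)).re = (c : ℝ) * (1 / 2) + d := by
      simp only [Complex.add_re, Complex.mul_re, Complex.intCast_re, Complex.intCast_im, zero_mul,
        sub_zero, ρ'_re]
    have him2 : ((c : ℂ) * ρ' + (d : ℂ)).im = (c : ℝ) * a₀ := by
      simp only [Complex.add_im, Complex.mul_im, Complex.intCast_re, Complex.intCast_im, zero_mul,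
        add_zero, ρ'_im]
    have e : Complex.normSq ((c : ℂ) * ρ' + (d : ℂ)) = (c : ℝ) ^ 2 + c * d + (d : ℝ) ^ 2 := by
      rw [Complex.normSq_apply, hre2, him2]; linear_combination (c : ℝ) ^ 2 * ha2
    have hsplit : (c : ℂ) * ρ' + (d : ℂ) = ((c : ℂ) * z + (d : ℂ)) - (c : ℂ) * ((z : ℂ) - ρ') := by ring
    have hnorm : ‖(c : ℂ) * ρ' + (d : ℂ)‖ ≤ ‖(c : ℂ) * z + (d : ℂ)‖ + ‖(c : ℂ)‖ * ‖(z : ℂ) - ρ'‖ := by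
      rw [hsplit]; refine (norm_sub_le _ _).trans ?_; rw [norm_mul]
    have hcn : ‖(c : ℂ)‖ ≤ 1 := by
      rw [Complex.norm_intCast]
      have : |c| ≤ 1 := by rw [abs_le]; constructor <;> nlinarith
      exact_mod_cast this
    have h1 : ‖(c : ℂ) * z + (d : ℂ)‖ ^ 2 < 11 / 10 := by rw [← Complex.normSq_eq_norm_sq]; exact hN1
    have h2 : ‖(c : ℂ) * ρ' + (d : ℂ)‖ ≤ ‖(c : ℂ) * z + (d : ℂ)‖ + a₀ / 10 := by
      refine hnorm.trans ?_
      have := mul_le_mul hcn hδ.le (norm_nonneg _) zero_le_one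
      linarith
    have h3 : ‖(c : ℂ) * z + (d : ℂ)‖ < 11 / 10 := by
      nlinarith [norm_nonneg ((c : ℂ) * z + (d : ℂ))]
    have h4 : ‖(c : ℂ) * ρ' + (d : ℂ)‖ < 13 / 10 := by linarith
    have h5 : Complex.normSq ((c : ℂ) * ρ' + (d : ℂ)) < 3 := by
      rw [Complex.normSq_eq_norm_sq]; nlinarith [norm_nonneg ((c : ℂ) * ρ' + (d : ℂ))]
    rw [e] at h5
    exact_mod_cast h5
  -- norms of `z`, `z − 1` are close to `1`
  have hz0 : (z : ℂ) ≠ 0 := UpperHalfPlane.ne_zero z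
  have hzn1 : 1 / 2 ≤ ‖(z : ℂ)‖ ∧ ‖(z : ℂ)‖ ≤ 2 := by
    have h1 : ‖(z : ℂ)‖ ≤ ‖(z : ℂ) - ρ'‖ + ‖ρ'‖ := norm_le_norm_sub_add _ _
    have h2 : ‖ρ'‖ ≤ ‖(z : ℂ) - ρ'‖ + ‖(z : ℂ)‖ := by
      have := norm_le_norm_sub_add ρ' (z : ℂ); rwa [norm_sub_rev] at this
    rw [norm_ρ'] at h1 h2
    constructor <;> linarith
  have hzn2 : 1 / 2 ≤ ‖(z : ℂ) - 1‖ ∧ ‖(z : ℂ) - 1‖ ≤ 2 := by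
    have e : (z : ℂ) - 1 = ((z : ℂ) - ρ') + (ρ' - 1) := by ring
    have h1 : ‖(z : ℂ) - 1‖ ≤ ‖(z : ℂ) - ρ'‖ + ‖ρ' - 1‖ := by rw [e]; exact norm_add_le _ _
    have h2 : ‖ρ' - 1‖ ≤ ‖(z : ℂ) - 1‖ + ‖(z : ℂ) - ρ'‖ := by
      have := norm_sub_le ((z : ℂ) - 1) ((z : ℂ) - ρ')
      rw [show (z : ℂ) - 1 - ((z : ℂ) - ρ') = ρ' - 1 by ring] at this; exact this
    rw [norm_ρ'_sub_one] at h1 h2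
    constructor <;> linarith
  have hz1 : (z : ℂ) - 1 ≠ 0 := fun h => by
    have := hzn2.1; rw [h, norm_zero] at this; linarith
  -- case analysis on the bottom row: `u = v + n` with `v ∈ {z, Sc z + 1, Sc (z − 1)}`
  have key : ∃ v : ℂ, (v = (z : ℂ) ∨ v = Sc (z : ℂ) + 1 ∨ v = Sc ((z : ℂ) - 1)) ∧
      ∃ n : ℤ, ((u : ℍ) : ℂ) = v + n := by
    rcases bottom_row_cases hc2 hm hcd0 with ⟨hc0, hd⟩ | ⟨hc1, hd⟩ | ⟨hc1, hd⟩
    · have had : a = d := by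
        rcases hd with hd | hd <;> · rw [hc0, hd] at hdet; linarith
      refine ⟨(z : ℂ), Or.inl rfl, b * d, ?_⟩
      rw [hcoe, hc0, had]
      rcases hd with hd | hd <;> · rw [hd]; push_cast; ring
    · rcases hd with hd0 | hd1
      · have hb : b = -1 := by rw [hc1, hd0] at hdet; linarith
        refine ⟨Sc (z : ℂ) + 1, Or.inr (Or.inl rfl), a - 1, ?_⟩
        rw [hcoe, hc1, hd0, hb, Sc]; push_cast
        rw [show (1 : ℂ) * (z : ℂ) + 0 = (z : ℂ) by ring]
        field_simp; ring
      · have hb : b = -a - 1 := by rw [hc1, hd1] at hdet; linarith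
        refine ⟨Sc ((z : ℂ) - 1), Or.inr (Or.inr rfl), a, ?_⟩
        rw [hcoe, hc1, hd1, hb, Sc]; push_cast
        rw [show (1 : ℂ) * (z : ℂ) + (-1 : ℂ) = (z : ℂ) - 1 by ring]
        field_simp; ring
    · rcases hd with hd0 | hd1
      · have hb : b = 1 := by rw [hc1, hd0] at hdet; linarith
        refine ⟨Sc (z : ℂ) + 1, Or.inr (Or.inl rfl), -a - 1, ?_⟩
        rw [hcoe, hc1, hd0, hb, Sc]; push_cast
        rw [show (-1 : ℂ) * (z : ℂ) + 0 = -(z : ℂ) by ring]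
        field_simp; ring
      · have hb : b = 1 - a := by rw [hc1, hd1] at hdet; linarith
        refine ⟨Sc ((z : ℂ) - 1), Or.inr (Or.inr rfl), -a, ?_⟩
        rw [hcoe, hc1, hd1, hb, Sc]; push_cast
        rw [show (-1 : ℂ) * (z : ℂ) + 1 = -((z : ℂ) - 1) by ring]
        field_simp; ring
  obtain ⟨v, hv, n, hn⟩ := key
  have hvim : a₀ < v.im := by
    have : u.im = v.im := by rw [← UpperHalfPlane.coe_im, hn]; simp
    rw [← this]; exact hua
  refine ⟨v, hvim, ?_, ?_⟩
  · rw [hFρ, hn]; exact Fbase_add_int hvim n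
  · have hSc : ∀ x y : ℂ, x ≠ 0 → y ≠ 0 → Sc x - Sc y = (x - y) / (x * y) := fun x y hx hy => by
      simp only [Sc]; field_simp; ring
    rcases hv with rfl | rfl | rfl
    · constructor <;> linarith [norm_nonneg ((z : ℂ) - ρ')]
    · have e : Sc (z : ℂ) + 1 - ρ' = ((z : ℂ) - ρ') / ((z : ℂ) * ρ') := by
        rw [show Sc (z : ℂ) + 1 - ρ' = Sc (z : ℂ) - Sc ρ' by rw [Sc_ρ']; ring]
        exact hSc _ _ hz0 ρ'_ne_zero
      rw [e, norm_div, norm_mul, norm_ρ', mul_one]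
      have hzpos : 0 < ‖(z : ℂ)‖ := norm_pos_iff.mpr hz0
      constructor
      · rw [div_le_iff₀ hzpos]; nlinarith [norm_nonneg ((z : ℂ) - ρ'), hzn1.1]
      · rw [mul_div_assoc']
        rw [le_div_iff₀ hzpos]; nlinarith [norm_nonneg ((z : ℂ) - ρ'), hzn1.2]
    · have e : Sc ((z : ℂ) - 1) - ρ' = ((z : ℂ) - ρ') / (((z : ℂ) - 1) * (ρ' - 1)) := by
        rw [show Sc ((z : ℂ) - 1) - ρ' = Sc ((z : ℂ) - 1) - Sc (ρ' - 1) by rw [Sc_ρ'_sub_one]]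
        rw [hSc _ _ hz1 (fun h => by simpa [h] using norm_ρ'_sub_one)]
        ring_nf
      rw [e, norm_div, norm_mul, norm_ρ'_sub_one, mul_one]
      have hzpos : 0 < ‖(z : ℂ) - 1‖ := norm_pos_iff.mpr hz1
      constructor
      · rw [div_le_iff₀ hzpos]; nlinarith [norm_nonneg ((z : ℂ) - ρ'), hzn2.1]
      · rw [mul_div_assoc']
        rw [le_div_iff₀ hzpos]; nlinarith [norm_nonneg ((z : ℂ) - ρ'), hzn2.2]

/-- **The logarithmic singularity of `Fρ` at `ρ'`**:
`Fρ(z) = −2a·log‖z − ρ'‖ + O(1)` for `z` off the orbit near `ρ'`. [folklore] -/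
theorem Fρ_log_bound : ∃ C ε : ℝ, 0 < ε ∧ ∀ z : ℍ, z ∉ MulAction.orbit (Gamma0 1) cmRho →
    ‖(z : ℂ) - ρ'‖ < ε → |Fρ z + 2 * aρ * Real.log ‖(z : ℂ) - ρ'‖| ≤ C := by
  obtain ⟨K, ε₁, hε₁, hK⟩ := Fbase_log_bound
  refine ⟨K + 2 * aρ * Real.log 2, min (a₀ / 10) (ε₁ / 2), lt_min (by linarith [a₀_pos]) (by linarith), fun z hz hd => ?_⟩
  have hd1 : ‖(z : ℂ) - ρ'‖ < a₀ / 10 := lt_of_lt_of_le hd (min_le_left _ _)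
  have hd2 : ‖(z : ℂ) - ρ'‖ < ε₁ / 2 := lt_of_lt_of_le hd (min_le_right _ _)
  obtain ⟨v, hvim, hF, hc1, hc2⟩ := rep_near_ρ' z hz hd1
  have hzne : (z : ℂ) - ρ' ≠ 0 := by
    intro h
    have : z = cmRho := by
      apply UpperHalfPlane.ext; rw [sub_eq_zero] at h; rw [h, ρ']
    exact hz (this ▸ MulAction.mem_orbit_self _)
  have hzpos : 0 < ‖(z : ℂ) - ρ'‖ := norm_pos_iff.mpr hzne
  have hvpos : 0 < ‖v - ρ'‖ := by linarith
  have hKv := hK v (by linarith) hvim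
  rw [hF]
  -- compare the logarithms
  have hlog : |Real.log ‖v - ρ'‖ - Real.log ‖(z : ℂ) - ρ'‖| ≤ Real.log 2 := by
    rw [← Real.log_div hvpos.ne' hzpos.ne', abs_le]
    constructor
    · rw [← Real.log_inv]
      apply Real.log_le_log (by positivity)
      rw [le_div_iff₀ hzpos]; linarith
    · apply Real.log_le_log (by positivity)
      rw [div_le_iff₀ hzpos]; linarith
  have e : Fbase v + 2 * aρ * Real.log ‖(z : ℂ) - ρ'‖ =
      (Fbase v + 2 * aρ * Real.log ‖v - ρ'‖) - 2 * aρ * (Real.log ‖v - ρ'‖ - Real.log ‖(z : ℂ) - ρ'‖) := by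
    ring
  rw [e]
  have ha : 0 ≤ 2 * aρ := by linarith [aρ_pos]
  calc |Fbase v + 2 * aρ * Real.log ‖v - ρ'‖ - 2 * aρ * (Real.log ‖v - ρ'‖ - Real.log ‖(z : ℂ) - ρ'‖)|
      ≤ |Fbase v + 2 * aρ * Real.log ‖v - ρ'‖| + |2 * aρ * (Real.log ‖v - ρ'‖ - Real.log ‖(z : ℂ) - ρ'‖)| :=
        abs_sub _ _
    _ ≤ K + 2 * aρ * Real.log 2 := by
        rw [abs_mul, abs_of_nonneg ha]
        gcongr

end NearCorner

/-! ## 9. Matching with `G₂^{Γ₀(1)}(·, ρ')` -/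

section Stabilizer

open ModularGroup CongruenceSubgroup
open scoped Modular

/-- **Fixed-point equation at `ρ'`**: `g • ρ' = ρ'` iff `a = c + d` and `b = −c`. [folklore] -/
theorem smul_cmRho_eq_iff (g : SL(2, ℤ)) :
    g • cmRho = cmRho ↔ g 0 0 = g 1 0 + g 1 1 ∧ g 0 1 = -g 1 0 := by
  have hρ : ((cmRho : ℍ) : ℂ) = ρ' := rfl
  have hden : ((g 1 0 : ℤ) : ℂ) * ρ' + ((g 1 1 : ℤ) : ℂ) ≠ 0 := by
    intro h0
    have him := congrArg Complex.im h0
    have hre := congrArg Complex.re h0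
    simp only [Complex.add_im, Complex.mul_im, Complex.intCast_re, Complex.intCast_im, zero_mul,
      add_zero, ρ'_im, Complex.zero_im, mul_eq_zero, a₀_pos.ne', or_false] at him
    simp only [Complex.add_re, Complex.mul_re, Complex.intCast_re, Complex.intCast_im, zero_mul,
      sub_zero, ρ'_re, Complex.zero_re] at hre
    have hc : g 1 0 = 0 := by exact_mod_cast him
    have hd : g 1 1 = 0 := by
      rw [hc] at hre; push_cast at hre
      have : ((g 1 1 : ℤ) : ℝ) = 0 := by linarith
      exact_mod_cast this
    have := det_int g
    rw [hc, hd] at this; simp at this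
  constructor
  · intro h
    have hc : ((g • cmRho : ℍ) : ℂ) = ρ' := by rw [h, hρ]
    rw [coe_smul_int, hρ, div_eq_iff hden] at hc
    -- `aρ' + b = ρ'(cρ' + d) = c(ρ'−1) + dρ'`
    have key : (((g 0 0 : ℤ) : ℂ) - (g 1 0 : ℤ) - (g 1 1 : ℤ)) * ρ' + ((g 0 1 : ℤ) + (g 1 0 : ℤ)) = 0 := by
      have e : ρ' * (((g 1 0 : ℤ) : ℂ) * ρ' + ((g 1 1 : ℤ) : ℂ)) =
          (g 1 0 : ℤ) * (ρ' * ρ') + (g 1 1 : ℤ) * ρ' := by ring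
      rw [e, ρ'_sq] at hc
      linear_combination hc
    have him := congrArg Complex.im key
    have hre := congrArg Complex.re key
    simp only [Complex.add_im, Complex.mul_im, Complex.sub_im, Complex.sub_re, Complex.intCast_re,
      Complex.intCast_im, zero_mul, add_zero, sub_zero, ρ'_im, ρ'_re, Complex.zero_im, mul_eq_zero,
      a₀_pos.ne', or_false] at him
    simp only [Complex.add_re, Complex.mul_re, Complex.sub_re, Complex.sub_im, Complex.intCast_re,
      Complex.intCast_im, zero_mul, sub_zero, ρ'_re, ρ'_im, Complex.zero_re] at hre
    have h1 : ((g 0 0 : ℤ) : ℝ) - (g 1 0 : ℤ) - (g 1 1 : ℤ) = 0 := him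
    rw [h1] at hre
    constructor
    · have : ((g 0 0 : ℤ) : ℝ) = (g 1 0 : ℤ) + (g 1 1 : ℤ) := by linarith
      exact_mod_cast this
    · have : ((g 0 1 : ℤ) : ℝ) = -(g 1 0 : ℤ) := by linarith
      exact_mod_cast this
  · rintro ⟨ha, hb⟩
    apply UpperHalfPlane.ext
    rw [coe_smul_int, hρ, ha, hb, div_eq_iff hden]
    push_cast
    have := ρ'_sq
    linear_combination (-((g 1 0 : ℤ) : ℂ)) * this

/-- The integer solutions of `c² + cd + d² = 1`. [folklore] -/
def unitPairs : Finset (ℤ × ℤ) := {(0, 1), (0, -1), (1, 0), (-1, 0), (1, -1), (-1, 1)}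

/-- Auxiliary step `mem_unitPairs_iff` of the Eichler-integral construction. [folklore] -/
theorem mem_unitPairs_iff (p : ℤ × ℤ) : p ∈ unitPairs ↔ p.1 ^ 2 + p.1 * p.2 + p.2 ^ 2 = 1 := by
  obtain ⟨c, d⟩ := p
  constructor
  · intro h
    simp only [unitPairs, Finset.mem_insert, Finset.mem_singleton, Prod.mk.injEq] at h
    rcases h with ⟨rfl, rfl⟩ | ⟨rfl, rfl⟩ | ⟨rfl, rfl⟩ | ⟨rfl, rfl⟩ | ⟨rfl, rfl⟩ | ⟨rfl, rfl⟩ <;> norm_num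
  · intro h
    simp only at h
    have hc : c ^ 2 < 2 := by nlinarith [sq_nonneg (2 * d + c)]
    have hcd0 : ¬(c = 0 ∧ d = 0) := by rintro ⟨rfl, rfl⟩; simp at h
    have := bottom_row_cases hc (by linarith) hcd0
    simp only [unitPairs, Finset.mem_insert, Finset.mem_singleton, Prod.mk.injEq]
    rcases this with ⟨rfl, rfl | rfl⟩ | ⟨rfl, rfl | rfl⟩ | ⟨rfl, rfl | rfl⟩ <;> simp

/-- Auxiliary step `card_unitPairs` of the Eichler-integral construction. [folklore] -/
theorem card_unitPairs : unitPairs.card = 6 := by decide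

/-- The matrix `(c+d, −c; c, d)` of determinant `c² + cd + d²`. [folklore] -/
def stabMat (p : ℤ × ℤ) (hp : p.1 ^ 2 + p.1 * p.2 + p.2 ^ 2 = 1) : SL(2, ℤ) :=
  ⟨!![p.1 + p.2, -p.1; p.1, p.2], by rw [Matrix.det_fin_two_of]; linarith⟩

/-- **`#Stab_{Γ₀(1)}(ρ') = 6`.** [folklore] -/
theorem card_stabilizer_cmRho : Nat.card (MulAction.stabilizer (Gamma0 1) cmRho) = 6 := by
  -- the stabilizer in `Γ₀(1)` ≃ solutions of `c² + cd + d² = 1`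
  let e : MulAction.stabilizer (Gamma0 1) cmRho ≃ {p : ℤ × ℤ // p ∈ unitPairs} :=
    { toFun := fun γ => ⟨(((γ : Gamma0 1) : SL(2, ℤ)) 1 0, ((γ : Gamma0 1) : SL(2, ℤ)) 1 1), by
        rw [mem_unitPairs_iff]
        have hγ := γ.2
        rw [MulAction.mem_stabilizer_iff] at hγ
        have hfix : ((γ : Gamma0 1) : SL(2, ℤ)) • cmRho = cmRho := hγ
        obtain ⟨ha, hb⟩ := (smul_cmRho_eq_iff _).mp hfix
        have hdet := det_int ((γ : Gamma0 1) : SL(2, ℤ))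
        rw [ha, hb] at hdet
        simp only
        linarith⟩
      invFun := fun p => ⟨⟨stabMat p.1 ((mem_unitPairs_iff _).mp p.2), mem_Gamma0_one _⟩, by
        rw [MulAction.mem_stabilizer_iff]
        have h := (smul_cmRho_eq_iff (stabMat p.1 ((mem_unitPairs_iff _).mp p.2))).mpr
          (by simp [stabMat])
        exact h⟩
      left_inv := fun γ => by
        apply Subtype.ext; apply Subtype.ext
        have hγ := γ.2
        rw [MulAction.mem_stabilizer_iff] at hγ
        have hfix : ((γ : Gamma0 1) : SL(2, ℤ)) • cmRho = cmRho := hγ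
        obtain ⟨ha, hb⟩ := (smul_cmRho_eq_iff _).mp hfix
        ext i j
        fin_cases i <;> fin_cases j <;> simp [stabMat, ha, hb]
      right_inv := fun p => by
        apply Subtype.ext
        simp [stabMat] }
  rw [Nat.card_congr e, Nat.card_eq_fintype_card, Fintype.card_coe, card_unitPairs]

end Stabilizer

section Matching

open ModularGroup CongruenceSubgroup
open scoped Modular

/-- The normalisation constant `C₀ := −#Stab(ρ')/a = −4608π²`. [folklore] -/
def C₀ : ℝ := -(6 : ℝ) / aρ

/-- Auxiliary step `C₀_eq` of the Eichler-integral construction. [folklore] -/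
theorem C₀_eq : C₀ = -(4608 : ℝ) * π ^ 2 := by
  rw [C₀, aρ]
  have : (π : ℝ) ≠ 0 := Real.pi_ne_zero
  field_simp; norm_num

/-- Euclidean closeness from hyperbolic closeness at `ρ'`. [folklore] -/
theorem exists_dist_lt_imp_norm_lt {ε : ℝ} (hε : 0 < ε) :
    ∃ δ : ℝ, 0 < δ ∧ ∀ z : ℍ, dist z cmRho < δ → ‖(z : ℂ) - ρ'‖ < ε := by
  have hc : ContinuousAt (fun z : ℍ => (z : ℂ)) cmRho := UpperHalfPlane.continuous_coe.continuousAt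
  obtain ⟨δ, hδ, h⟩ := Metric.continuousAt_iff.mp hc ε hε
  exact ⟨δ, hδ, fun z hz => by simpa [dist_eq_norm, ρ'] using h hz⟩

variable (hreal : (M₁ Complex.I).im = 0)
include hreal

/-- **`G₂^{Γ₀(1)}(z, ρ') = C₀ · Fρ(z)` off the orbit of `ρ'`** (uniqueness of the resolvent Green
function). [cite: GrossZagier1986, §II.2] -/
theorem higherGreen_eq_C₀_mul_Fρ (z : ℍ) (hz : z ∉ MulAction.orbit (Gamma0 1) cmRho) :
    higherGreen 1 2 1 z cmRho = C₀ * Fρ z := by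
  obtain ⟨hG, CG, εG, hεG, hGsing⟩ := higherGreen_isResolventGreenLike_holds 1 2 one_pos le_rfl cmRho
  have hF : IsResolventGreenLike 1 2 cmRho (fun z => C₀ * Fρ z) := (isResolventGreenLike_Fρ hreal).const_mul C₀
  obtain ⟨CF, εF, hεF, hFsing⟩ := Fρ_log_bound
  obtain ⟨δ, hδ, hδε⟩ := exists_dist_lt_imp_norm_lt hεF
  symm
  refine resolventGreen_unique_holds 1 2 one_pos le_rfl cmRho (fun z => C₀ * Fρ z)
    (fun z => higherGreen 1 2 1 z cmRho) hF hG ⟨|C₀| * CF + CG, min δ εG, lt_min hδ hεG, ?_⟩ z hz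
  intro w hw hwo
  have hw1 : dist w cmRho < δ := lt_of_lt_of_le hw (min_le_left _ _)
  have hw2 : dist w cmRho < εG := lt_of_lt_of_le hw (min_le_right _ _)
  have hwne : w ≠ cmRho := fun h => hwo (h ▸ MulAction.mem_orbit_self _)
  have h1 := hFsing w hwo (hδε w hw1)
  have h2 := hGsing w hw2 hwne
  rw [card_stabilizer_cmRho] at h2
  have hdist : dist (w : ℂ) (cmRho : ℂ) = ‖(w : ℂ) - ρ'‖ := by rw [dist_eq_norm, ρ']
  rw [hdist] at h2
  have hpos : 0 < ‖(w : ℂ) - ρ'‖ := by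
    rw [norm_pos_iff, sub_ne_zero]
    intro h; apply hwne; apply UpperHalfPlane.ext; rw [h, ρ']
  rw [Real.log_pow] at h2
  have h2' : |higherGreen 1 2 1 w cmRho - 6 * (2 * Real.log ‖(w : ℂ) - ρ'‖)| ≤ CG := by
    simpa using h2
  -- `C₀ (Fρ + 2a log) − (G − 12 log) = C₀ Fρ − G` since `2 a C₀ = −12`
  have hC : C₀ * (2 * aρ) = -12 := by
    rw [C₀]; field_simp [aρ_pos.ne']; ring
  have e : C₀ * Fρ w - higherGreen 1 2 1 w cmRho =
      C₀ * (Fρ w + 2 * aρ * Real.log ‖(w : ℂ) - ρ'‖) -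
        (higherGreen 1 2 1 w cmRho - (6 : ℝ) * (2 * Real.log ‖(w : ℂ) - ρ'‖)) := by
    linear_combination -(Real.log ‖(w : ℂ) - ρ'‖) * hC
  rw [e]
  calc |C₀ * (Fρ w + 2 * aρ * Real.log ‖(w : ℂ) - ρ'‖) -
        (higherGreen 1 2 1 w cmRho - 6 * (2 * Real.log ‖(w : ℂ) - ρ'‖))|
      ≤ |C₀ * (Fρ w + 2 * aρ * Real.log ‖(w : ℂ) - ρ'‖)| +
        |higherGreen 1 2 1 w cmRho - 6 * (2 * Real.log ‖(w : ℂ) - ρ'‖)| := abs_sub _ _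
    _ ≤ |C₀| * CF + CG := by
        rw [abs_mul]
        gcongr

/-- In particular at `z = i`: `G₂(i, ρ') = C₀ · Fbase(i)`. [cite: Zhou2015, Remark 9] -/
theorem higherGreen_I_cmRho : higherGreen 1 2 1 UpperHalfPlane.I cmRho = C₀ * Fbase Complex.I := by
  have hI : UpperHalfPlane.I ∉ MulAction.orbit (Gamma0 1) cmRho := fun h => by
    have := im_le_a₀_of_mem_orbit h
    rw [UpperHalfPlane.I_im] at this
    linarith [a₀_lt_one]
  rw [higherGreen_eq_C₀_mul_Fρ hreal _ hI]
  congr 1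
  have hfd : (1 : SL(2, ℤ)) • UpperHalfPlane.I ∈ 𝒟 := by
    rw [one_smul]
    refine ⟨by simp [Complex.normSq_apply], by simp⟩
  rw [Fρ_eq_of_smul_mem_fd hreal hI hfd, one_smul, UpperHalfPlane.coe_I]

end Matching

/-! ## 10. The value at `i` -/

section ValueAtI

/-- `Fbase(i) = 2 Im M₀(i)` (pure algebra from `c₀ = −c₂`, `c₁ = 2M₁(i)`). [folklore] -/
theorem Fbase_I : Fbase Complex.I = 2 * (M₀ Complex.I).im := by
  rw [Fbase, lam, c₀_eq, c₂, A₂, A₁, Complex.I_sq]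
  simp only [Complex.I_im, div_one, Complex.neg_im, Complex.sub_im, Complex.add_im, Complex.mul_im,
    Complex.mul_re, Complex.I_re, Complex.sub_re, zero_mul, one_mul, mul_one, mul_zero, sub_zero,
    zero_add, add_zero, Complex.re_ofNat, Complex.im_ofNat, Complex.neg_re, Complex.one_re,
    Complex.one_im, neg_zero]
  ring

/-- `M₀(i) = i ∫_{t>1} f(it) dt`. [folklore] -/
theorem M₀_I : M₀ Complex.I = Complex.I * ∫ t in Ioi (1 : ℝ), fΔE4 (EllipticCurves.ModularForms.axisPt t) := by
  rw [M₀, Pk, powPrimitive_zero]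
  have hpos : 0 < (Complex.I - (a₀ : ℂ) * Complex.I).im := by simp; exact a₀_lt_one
  rw [eichlerPrimitive, ofComplex_apply_of_im_pos hpos]
  congr 1
  -- `φρ(ofComplex((1 − a₀)i + t i)) = f(axisPt (1 + t))`, then shift `t ↦ t − 1`
  have hpt : ∀ t : ℝ, 0 < t →
      φρ (ofComplex (Complex.I - (a₀ : ℂ) * Complex.I + t * Complex.I)) = fΔE4 (EllipticCurves.ModularForms.axisPt (1 + t)) := by
    intro t ht
    have him : a₀ < (Complex.I + (t : ℂ) * Complex.I).im := by simp; linarith [a₀_lt_one]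
    have := φρ_ofComplex_sub him
    rw [show Complex.I + (t : ℂ) * Complex.I - (a₀ : ℂ) * Complex.I =
      Complex.I - (a₀ : ℂ) * Complex.I + t * Complex.I by ring] at this
    rw [this]
    congr 1
    apply UpperHalfPlane.ext
    rw [ofComplex_apply_of_im_pos (by simp; linarith : 0 < (Complex.I + (t : ℂ) * Complex.I).im),
      EllipticCurves.ModularForms.coe_axisPt (by linarith)]
    change Complex.I + (t : ℂ) * Complex.I = _
    push_cast; ring
  rw [setIntegral_congr_fun measurableSet_Ioi (fun t (ht : t ∈ Ioi (0:ℝ)) => hpt t ht)]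
  -- translation
  have h1 : ∫ t in Ioi (0 : ℝ), fΔE4 (EllipticCurves.ModularForms.axisPt (1 + t)) =
      ∫ t, (Ioi (1 : ℝ)).indicator (fun s => fΔE4 (EllipticCurves.ModularForms.axisPt s)) (t + 1) := by
    rw [← integral_indicator measurableSet_Ioi]
    congr 1; funext t
    simp only [Set.indicator]
    have : t ∈ Ioi (0 : ℝ) ↔ t + 1 ∈ Ioi (1 : ℝ) := by simp
    by_cases ht : t ∈ Ioi (0 : ℝ)
    · rw [if_pos ht, if_pos (this.mp ht), add_comm]
    · rw [if_neg ht, if_neg (fun h => ht (this.mpr h))]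
  rw [h1, MeasureTheory.integral_add_right_eq_self, integral_indicator measurableSet_Ioi]

end ValueAtI

/-! ## 11. Assembly of Remark 9 (ii)a given the two real-axis inputs -/

section Final

/-- Points of the shifted axis: `φρ(ofComplex((1 − a₀)i + u i)) = f(EllipticCurves.ModularForms.axisPt (1 + u))`. [folklore] -/
theorem φρ_ofComplex_axis {u : ℝ} (hu : 0 < u) :
    φρ (ofComplex (Complex.I - (a₀ : ℂ) * Complex.I + u * Complex.I)) = fΔE4 (EllipticCurves.ModularForms.axisPt (1 + u)) := by
  have him : a₀ < (Complex.I + (u : ℂ) * Complex.I).im := by simp; linarith [a₀_lt_one]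
  have := φρ_ofComplex_sub him
  rw [show Complex.I + (u : ℂ) * Complex.I - (a₀ : ℂ) * Complex.I =
    Complex.I - (a₀ : ℂ) * Complex.I + u * Complex.I by ring] at this
  rw [this]
  congr 1
  apply UpperHalfPlane.ext
  rw [ofComplex_apply_of_im_pos (by simp; linarith : 0 < (Complex.I + (u : ℂ) * Complex.I).im),
    EllipticCurves.ModularForms.coe_axisPt (by linarith)]
  change Complex.I + (u : ℂ) * Complex.I = _
  push_cast; ring

variable {r : ℝ → ℝ} (hr : ∀ t : ℝ, 0 < t → fΔE4 (EllipticCurves.ModularForms.axisPt t) = (r t : ℂ))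
include hr

/-- `Im M₁(i) = 0` when `f` is real on the imaginary axis. [folklore] -/
theorem M₁_I_im_eq_zero : (M₁ Complex.I).im = 0 := by
  have hpos : 0 < (Complex.I - (a₀ : ℂ) * Complex.I).im := by simp; exact a₀_lt_one
  set τ₀ : ℂ := Complex.I - (a₀ : ℂ) * Complex.I with hτ₀
  -- `M₁(i) = i·M₀(i) + E₂(τ₀)`
  have hE : eichlerPrimitive φρ (ofComplex τ₀) = M₀ Complex.I := by rw [M₀, Pk, powPrimitive_zero]
  have hM1 : M₁ Complex.I = Complex.I * M₀ Complex.I +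
      eichlerPrimitive (eichlerPrimitive φρ) (ofComplex τ₀) := by
    rw [M₁, Pk, Pk, powPrimitive_succ, powPrimitive_zero, powPrimitive_zero, hE,
      ofComplex_apply_of_im_pos hpos]
    change (τ₀) ^ 1 * M₀ Complex.I + _ + _ = _
    push_cast; ring
  -- `M₀(i) = i · (real)`
  have hM0 : M₀ Complex.I = Complex.I * ((∫ t in Ioi (1 : ℝ), r t : ℝ) : ℂ) := by
    rw [M₀_I, ← integral_complex_ofReal]
    congr 1
    exact setIntegral_congr_fun measurableSet_Ioi fun t ht => hr t (zero_lt_one.trans ht)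
  -- the inner primitive on the shifted axis is `i · (real)`
  have hinner : ∀ t : ℝ, 0 < t → eichlerPrimitive φρ (ofComplex (τ₀ + t * Complex.I)) =
      Complex.I * ((∫ s in Ioi (0 : ℝ), r (1 + t + s) : ℝ) : ℂ) := by
    intro t ht
    have hpos' : 0 < (τ₀ + t * Complex.I).im := by rw [hτ₀]; simp; linarith [a₀_lt_one]
    rw [eichlerPrimitive, ofComplex_apply_of_im_pos hpos', ← integral_complex_ofReal]
    congr 1
    refine setIntegral_congr_fun measurableSet_Ioi fun s hs => ?_
    change φρ (ofComplex (τ₀ + (t : ℂ) * Complex.I + (s : ℂ) * Complex.I)) = _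
    have hts : 0 < t + s := add_pos ht hs
    have := φρ_ofComplex_axis hts
    rw [hτ₀, show Complex.I - (a₀ : ℂ) * Complex.I + (t : ℂ) * Complex.I + (s : ℂ) * Complex.I =
      Complex.I - (a₀ : ℂ) * Complex.I + ((t + s : ℝ) : ℂ) * Complex.I by push_cast; ring, this,
      hr _ (by linarith), show 1 + (t + s) = 1 + t + s by ring]
  have hE2 : eichlerPrimitive (eichlerPrimitive φρ) (ofComplex τ₀) =
      -((∫ t in Ioi (0 : ℝ), ∫ s in Ioi (0 : ℝ), r (1 + t + s) : ℝ) : ℂ) := by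
    rw [eichlerPrimitive, ofComplex_apply_of_im_pos hpos]
    change Complex.I * ∫ t in Ioi (0 : ℝ), eichlerPrimitive φρ (ofComplex (τ₀ + t * Complex.I)) = _
    rw [setIntegral_congr_fun measurableSet_Ioi fun t (ht : t ∈ Ioi (0 : ℝ)) => hinner t ht,
      integral_const_mul, integral_complex_ofReal, ← mul_assoc, Complex.I_mul_I]
    ring
  rw [hM1, hM0, hE2, ← mul_assoc, Complex.I_mul_I]
  simp

variable {L : ℝ} (hL : ∫ t in Ioi (1 : ℝ), fΔE4 (EllipticCurves.ModularForms.axisPt t) = (((1728 * π)⁻¹ * L : ℝ) : ℂ))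
include hL

/-- **Remark 9 (ii)a from the two axis inputs**:
`G₂^{PSL₂(ℤ)}(ρ', i) = −(16π/3)·L` where `L = 1728π ∫_{t>1} Δ(it)/E₄(it)² dt`. [cite: Zhou2015, Remark 9] -/
theorem higherGreen_cmRho_I_of_axis : higherGreen 1 2 1 cmRho UpperHalfPlane.I = -(16 * π / 3) * L := by
  rw [higherGreen_symm one_pos, higherGreen_I_cmRho (M₁_I_im_eq_zero hr), Fbase_I, M₀_I, hL, C₀_eq]
  simp only [Complex.mul_im, Complex.I_re, Complex.I_im, Complex.ofReal_re, Complex.ofReal_im,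
    zero_mul, one_mul, zero_add]
  have hπ : (π : ℝ) ≠ 0 := Real.pi_ne_zero
  field_simp
  ring

end Final

end Literature.NumberTheory.Automorphic.GreenRho
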